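import Literature.Computability.Cryptography.VanDamSeroussiCubicBlock
import HarnessLib

/-!
# The quantum block of the cubic Gauss-sum experiment, II: semantics of the stages

Topic `Literature/Computability/Cryptography`; sequel of `VanDamSeroussiCubicBlock.lean` (layout and
gates of one block of the experiment behind `VanDamSeroussi2002_cubicGaussSumPhase_qsolvable_holds`).
This file computes what the stages do to basis labels and to the superpositions the block produces
(van Dam–Seroussi 2002, §4, proof of Thm. 1, steps 1–3, in the tree's realisation):

* arithmetic of registers: `bitsToNat_bitsLE` (the little-endian bits of `v` on `w` wires read back
  as `v mod 2ʷ`), `testBit_bitsToNat` / `decide_getElem?_eq` (bit `j` of the numeral a machine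
  writes is bit `j` of its value);
* `Vmap`, **`V_mulVec_tri`** — the block `V` of the eigenvalue measurement is a basis map that keeps
  the first part and the tests of the three-part label `tri x y ρ` and acts on the work part by a map
  `A x y ρ` (so `KitaevModePhaseEstimation.kitaevCircuit_mulVec_superposition` applies), and
  **`A_good`**: on a good label (`Y = yv`, `P = 0`, area clean, constants in place) `A` moves
  `yv` to `P`, shifted by the weighted exponent of the tests modulo `N`, and clears `Y`
  (`peSubVal_peAddVal`).

Everything here is proved; no definition without body, no named fact.

## References

* W. van Dam, G. Seroussi, arXiv:quant-ph/0207131 (2002), §4 Thm. 1 [VanDamSeroussi2002].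
* A. Yu. Kitaev, arXiv:quant-ph/9511026 (1995), §3 Lemma 10, §5 [Kitaev1995].
-/

noncomputable section

namespace Literature.Computability.Cryptography

namespace VanDamSeroussi

namespace CubicBlock

open _root_.Computability Complexity QuantumComplexity QuantumComplexity.RevSim QuantumComplexity.RevClean Kitaev1995 Matrix
open Literature.Computability.Complexity.CodeFP (strE natE bitE pairE)

/-! ### Arithmetic of registers -/

/-- The value of the little-endian bits of `v` on `w` wires is `v mod 2ʷ`. [folklore] -/
theorem bitsToNat_map_testBit (v : ℕ) : ∀ (s w : ℕ),
    bitsToNat ((List.range w).map fun i => v.testBit (s + i)) = v / 2 ^ s % 2 ^ w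
  | s, 0 => by simp [Nat.mod_one]
  | s, w + 1 => by
    rw [List.range_succ_eq_map, List.map_cons, List.map_map, bitsToNat_cons]
    have hcomp : ((fun i => v.testBit (s + i)) ∘ Nat.succ) = fun i => v.testBit (s + 1 + i) := by
      funext i; simp only [Function.comp_apply, Nat.succ_eq_add_one]; ring_nf
    have e1 : v / 2 ^ (s + 1) = v / 2 ^ s / 2 := by rw [pow_succ, Nat.div_div_eq_div_mul]
    have e2 : v / 2 ^ s % 2 ^ (w + 1) = v / 2 ^ s % 2 + 2 * (v / 2 ^ s / 2 % 2 ^ w) := by rw [pow_succ', Nat.mod_mul]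
    rw [hcomp, bitsToNat_map_testBit v (s + 1) w, Nat.add_zero, e1, e2, Nat.testBit_eq_decide_div_mod_eq]
    rcases Nat.mod_two_eq_zero_or_one (v / 2 ^ s) with h | h <;> simp [h]

/-- The value of `bitsLE v w` is `v mod 2ʷ`. [folklore] -/
theorem bitsToNat_bitsLE (v w : ℕ) : bitsToNat (Layout.bitsLE v w) = v % 2 ^ w := by
  have h := bitsToNat_map_testBit v 0 w
  simp only [Nat.zero_add, pow_zero, Nat.div_one] at h
  exact h

/-- Bit `j` of the value of a bit string is its entry `j`. [folklore] -/
theorem testBit_bitsToNat : ∀ (l : List Bool) (j : ℕ), (bitsToNat l).testBit j = l.getD j false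
  | [], j => by simp
  | b :: l, 0 => by cases b <;> simp [Nat.testBit_zero, Nat.add_mod]
  | b :: l, j + 1 => by
    rw [bitsToNat_cons, Nat.testBit_succ, List.getD_cons_succ, ← testBit_bitsToNat l j]
    congr 1
    cases b <;> simp [Nat.add_mul_div_left]

/-- The bit a clean XOR block writes: `[l'[j]? = some true]` is entry `j` of `l'`. [folklore] -/
theorem decide_getElem?_eq (l : List Bool) (j : ℕ) : decide (l[j]? = some true) = l.getD j false := by
  rw [List.getD_eq_getElem?_getD]
  cases h : l[j]? with
  | none => simp
  | some b => cases b <;> simp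

/-- Bit `j` of the numeral of `v` is bit `j` of `v`. [folklore] -/
theorem decide_getElem?_natE (v j : ℕ) : decide ((natE v)[j]? = some true) = v.testBit j := by
  rw [decide_getElem?_eq, ← testBit_bitsToNat, show bitsToNat (natE v) = v from bitsToNat_encodeNat v]

namespace Layout

variable (Λ : Layout)

/-! ### The block `V` as a basis map on three-part labels -/

/-- The classical map of `V`: move-and-add, then un-move. [folklore] -/
def Vmap : QReg Λ.Wd → QReg Λ.Wd :=
  clEval (PXor.ops Λ.Wd_pos mach₅.e mach₅.M Λ.as Λ.fs₅ Λ.kap Λ.Y) ∘ clEval (PXor.ops Λ.Wd_pos mach₄.e mach₄.M Λ.as Λ.fs₄ Λ.kap Λ.P)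

/-- `V` is the basis map of `Vmap`. [folklore] -/
theorem V_isBasisMap : IsBasisMap (Λ.V.toMatrix 0) Λ.Vmap := by
  rw [V, QCircuit.toMatrix_append]
  exact (PXor.isBasisMap_circuit Λ.geom₅).mul (PXor.isBasisMap_circuit Λ.geom₄)

/-- `Vmap` keeps every wire outside `Y` and `P`. [folklore] -/
theorem Vmap_apply_of_lt (z : QReg Λ.Wd) (q : Fin Λ.Wd) (hq : (q : ℕ) < Λ.n₁ + Λ.k) : Λ.Vmap z q = z q := by
  have hY : ∀ j, j < Λ.kap → q ≠ CleanXor.tgt Λ.Wd_pos Λ.Y j := fun j hj h => by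
    have := congrArg Fin.val h
    rw [CleanXor.tgt, val_finOf_of_lt _ (Λ.Y_lt_Wd hj)] at this
    simp only [Y] at this; omega
  have hP : ∀ j, j < Λ.kap → q ≠ CleanXor.tgt Λ.Wd_pos Λ.P j := fun j hj h => by
    have := congrArg Fin.val h
    rw [CleanXor.tgt, val_finOf_of_lt _ (Λ.P_lt_Wd hj)] at this
    simp only [P] at this; omega
  unfold Vmap
  rw [Function.comp_apply, PXor.clEval_ops_of_ne Λ.geom₅ _ q hY, PXor.clEval_ops_of_ne Λ.geom₄ _ q hP]

/-- The action of `V` on the work part. [folklore] -/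
def A (x : QReg Λ.n₁) (y : QReg Λ.k) (ρ : QReg (Λ.kap + Λ.kap)) : QReg (Λ.kap + Λ.kap) :=
  fun l => Λ.Vmap (tri x y ρ) (Fin.natAdd Λ.n₁ (Fin.natAdd Λ.k l))

/-- **`V` keeps the first part and the tests and acts on the work part by `A`.** [cite: Kitaev1995, §3 Lemma 10] -/
theorem V_mulVec_tri (x : QReg Λ.n₁) (y : QReg Λ.k) (ρ : QReg (Λ.kap + Λ.kap)) :
    Λ.V.toMatrix 0 *ᵥ basisState (tri x y ρ) = basisState (tri x y (Λ.A x y ρ)) := by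
  rw [Λ.V_isBasisMap]
  congr 1
  rw [← tri_parts (Λ.Vmap (tri x y ρ))]
  refine tri_eq_tri_iff.2 ⟨funext fun i => ?_, funext fun j => ?_, rfl⟩
  · rw [Λ.Vmap_apply_of_lt _ _ (by simp; omega), tri_castAdd]
  · rw [Λ.Vmap_apply_of_lt _ _ (by rw [val_coinWire]; omega), tri_coinWire]

/-! ### Reading registers off three-part labels -/

/-- A three-part label on a wire of the first part. [folklore] -/
theorem tri_fin_of_lt (x : QReg Λ.n₁) (y : QReg Λ.k) (ρ : QReg (Λ.kap + Λ.kap)) {q : ℕ} (hq : q < Λ.n₁) :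
    tri x y ρ (Λ.fin q) = x ⟨q, hq⟩ := by
  have hW : q < Λ.Wd := by have := Λ.n₁_le_Wd; omega
  rw [fin, finOf_of_lt _ hW, show (⟨q, hW⟩ : Fin Λ.Wd) = Fin.castAdd _ ⟨q, hq⟩ from rfl, tri_castAdd]

/-- A three-part label on a test wire. [folklore] -/
theorem tri_fin_tst (x : QReg Λ.n₁) (y : QReg Λ.k) (ρ : QReg (Λ.kap + Λ.kap)) {i : ℕ} (hi : i < Λ.k) :
    tri x y ρ (Λ.fin (Λ.tst i)) = y ⟨i, hi⟩ := by
  rw [fin, finOf_of_lt _ (Λ.tst_lt_Wd hi), show (⟨Λ.tst i, Λ.tst_lt_Wd hi⟩ : Fin Λ.Wd) = coinWire Λ.n₁ Λ.k _ ⟨i, hi⟩ from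
    Fin.ext (by rw [val_coinWire]; rfl), tri_coinWire]

/-- A three-part label on a `Y` wire. [folklore] -/
theorem tri_fin_Y (x : QReg Λ.n₁) (y : QReg Λ.k) (ρ : QReg (Λ.kap + Λ.kap)) {i : ℕ} (hi : i < Λ.kap) :
    tri x y ρ (Λ.fin (Λ.Y i)) = ρ ⟨i, by omega⟩ := by
  rw [fin, finOf_of_lt _ (Λ.Y_lt_Wd hi), show (⟨Λ.Y i, Λ.Y_lt_Wd hi⟩ : Fin Λ.Wd) =
    Fin.natAdd Λ.n₁ (Fin.natAdd Λ.k ⟨i, by omega⟩) from Fin.ext (by simp [Y]; omega), tri_work]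

/-- A three-part label on a `P` wire. [folklore] -/
theorem tri_fin_P (x : QReg Λ.n₁) (y : QReg Λ.k) (ρ : QReg (Λ.kap + Λ.kap)) {i : ℕ} (hi : i < Λ.kap) :
    tri x y ρ (Λ.fin (Λ.P i)) = ρ ⟨Λ.kap + i, by omega⟩ := by
  rw [fin, finOf_of_lt _ (Λ.P_lt_Wd hi), show (⟨Λ.P i, Λ.P_lt_Wd hi⟩ : Fin Λ.Wd) =
    Fin.natAdd Λ.n₁ (Fin.natAdd Λ.k ⟨Λ.kap + i, by omega⟩) from Fin.ext (by simp [P]; omega), tri_work]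

/-- The work part `Y = yv`, `P = pv` (little-endian bits). [folklore] -/
def yp (yv pv : ℕ) : QReg (Λ.kap + Λ.kap) := fun l => if (l : ℕ) < Λ.kap then yv.testBit l else pv.testBit (l - Λ.kap)

/-- **Good first parts for `V`**: the work area is clean and the constant registers `N`, `2B` hold
their values. [folklore] -/
structure XGood (x : QReg Λ.n₁) : Prop where
  /-- the area `[as, n₁)` is clean -/
  area : ∀ q (hq : q < Λ.n₁), Λ.as ≤ q → x ⟨q, hq⟩ = false
  /-- `N` in place -/
  nreg : ∀ i (hi : i < Λ.kap + 1), x ⟨Λ.Nreg i, lt_of_lt_of_le (Λ.Nreg_lt_as hi) Λ.as_le_n₁⟩ = Λ.Nmod.testBit i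
  /-- `2B` in place -/
  bpreg : ∀ i (hi : i < Λ.wB), x ⟨Λ.BPreg i, lt_of_lt_of_le (Λ.BPreg_lt_as hi) Λ.as_le_n₁⟩ = Λ.Bper.testBit i

/-- The registers read by the move-and-add block off a three-part label. [folklore] -/
theorem regs_fs₄ (x : QReg Λ.n₁) (hx : Λ.XGood x) (y : QReg Λ.k) (yv pv : ℕ) :
    PXor.regs Λ.Wd_pos Λ.fs₄ (tri x y (Λ.yp yv pv)) =
      [Layout.bitsLE yv Λ.kap, List.ofFn y, Layout.bitsLE Λ.Nmod (Λ.kap + 1), Layout.bitsLE Λ.Bper Λ.wB] := by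
  simp only [PXor.regs, fs₄, regs, ps₄, List.map_cons, List.map_nil, reg, List.map_map, List.cons.injEq, and_true]
  refine ⟨?_, ?_, ?_, ?_⟩
  · refine List.map_congr_left fun i hi => ?_
    rw [List.mem_range] at hi
    rw [Function.comp_apply, show finOf Λ.Wd Λ.Wd_pos (Λ.Y i) = Λ.fin (Λ.Y i) from rfl, Λ.tri_fin_Y _ _ _ hi, yp]
    simp [hi]
  · apply List.ext_getElem
    · simp
    · intro i h1 h2
      rw [List.length_map, List.length_range] at h1
      simp only [List.getElem_map, List.getElem_range, Function.comp_apply, List.getElem_ofFn]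
      exact Λ.tri_fin_tst _ _ _ h1
  · refine List.map_congr_left fun i hi => ?_
    rw [List.mem_range] at hi
    rw [Function.comp_apply, show finOf Λ.Wd Λ.Wd_pos (Λ.Nreg i) = Λ.fin (Λ.Nreg i) from rfl,
      Λ.tri_fin_of_lt _ _ _ (lt_of_lt_of_le (Λ.Nreg_lt_as hi) Λ.as_le_n₁), hx.nreg i hi]
  · refine List.map_congr_left fun i hi => ?_
    rw [List.mem_range] at hi
    rw [Function.comp_apply, show finOf Λ.Wd Λ.Wd_pos (Λ.BPreg i) = Λ.fin (Λ.BPreg i) from rfl,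
      Λ.tri_fin_of_lt _ _ _ (lt_of_lt_of_le (Λ.BPreg_lt_as hi) Λ.as_le_n₁), hx.bpreg i hi]

/-- The registers read by the un-move block off a three-part label. [folklore] -/
theorem regs_fs₅ (x : QReg Λ.n₁) (hx : Λ.XGood x) (y : QReg Λ.k) (yv pv : ℕ) :
    PXor.regs Λ.Wd_pos Λ.fs₅ (tri x y (Λ.yp yv pv)) =
      [Layout.bitsLE pv Λ.kap, List.ofFn y, Layout.bitsLE Λ.Nmod (Λ.kap + 1), Layout.bitsLE Λ.Bper Λ.wB] := by
  simp only [PXor.regs, fs₅, regs, ps₅, List.map_cons, List.map_nil, reg, List.map_map, List.cons.injEq, and_true]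
  refine ⟨?_, ?_, ?_, ?_⟩
  · refine List.map_congr_left fun i hi => ?_
    rw [List.mem_range] at hi
    rw [Function.comp_apply, show finOf Λ.Wd Λ.Wd_pos (Λ.P i) = Λ.fin (Λ.P i) from rfl, Λ.tri_fin_P _ _ _ hi, yp]
    simp
  · apply List.ext_getElem
    · simp
    · intro i h1 h2
      rw [List.length_map, List.length_range] at h1
      simp only [List.getElem_map, List.getElem_range, Function.comp_apply, List.getElem_ofFn]
      exact Λ.tri_fin_tst _ _ _ h1
  · refine List.map_congr_left fun i hi => ?_
    rw [List.mem_range] at hi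
    rw [Function.comp_apply, show finOf Λ.Wd Λ.Wd_pos (Λ.Nreg i) = Λ.fin (Λ.Nreg i) from rfl,
      Λ.tri_fin_of_lt _ _ _ (lt_of_lt_of_le (Λ.Nreg_lt_as hi) Λ.as_le_n₁), hx.nreg i hi]
  · refine List.map_congr_left fun i hi => ?_
    rw [List.mem_range] at hi
    rw [Function.comp_apply, show finOf Λ.Wd Λ.Wd_pos (Λ.BPreg i) = Λ.fin (Λ.BPreg i) from rfl,
      Λ.tri_fin_of_lt _ _ _ (lt_of_lt_of_le (Λ.BPreg_lt_as hi) Λ.as_le_n₁), hx.bpreg i hi]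

/-- `Y` wire `i` as a work wire of the three-part layout. [folklore] -/
theorem fin_Y_eq {i : ℕ} (hi : i < Λ.kap) : Λ.fin (Λ.Y i) = Fin.natAdd Λ.n₁ (Fin.natAdd Λ.k ⟨i, by omega⟩) := by
  rw [fin, finOf_of_lt _ (Λ.Y_lt_Wd hi)]; exact Fin.ext (by simp [Y]; omega)

/-- `P` wire `i` as a work wire of the three-part layout. [folklore] -/
theorem fin_P_eq {i : ℕ} (hi : i < Λ.kap) : Λ.fin (Λ.P i) = Fin.natAdd Λ.n₁ (Fin.natAdd Λ.k ⟨Λ.kap + i, by omega⟩) := by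
  rw [fin, finOf_of_lt _ (Λ.P_lt_Wd hi)]; exact Fin.ext (by simp [P]; omega)

/-- A label that agrees with `tri x y ρ` before the work part and reads `ρ'` on it IS `tri x y ρ'`. [folklore] -/
theorem eq_tri_of_parts {x : QReg Λ.n₁} {y : QReg Λ.k} {ρ ρ' : QReg (Λ.kap + Λ.kap)} {z' : QReg Λ.Wd}
    (hxy : ∀ q : Fin Λ.Wd, (q : ℕ) < Λ.n₁ + Λ.k → z' q = tri x y ρ q)
    (hw : ∀ l : Fin (Λ.kap + Λ.kap), z' (Fin.natAdd Λ.n₁ (Fin.natAdd Λ.k l)) = ρ' l) : z' = tri x y ρ' := by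
  funext q
  induction q using Fin.addCases with
  | left i => rw [hxy _ (by simp; omega), tri_castAdd, tri_castAdd]
  | right i =>
    induction i using Fin.addCases with
    | left j =>
      rw [show Fin.natAdd Λ.n₁ (Fin.castAdd (Λ.kap + Λ.kap) j) = coinWire Λ.n₁ Λ.k _ j from rfl,
        hxy _ (by rw [val_coinWire]; omega), tri_coinWire, tri_coinWire]
    | right l => rw [hw l, tri_work]

/-- The pair string read by the move-and-add block is the code its machine expects. [folklore] -/
theorem pairStr_regs_fs₄ (x : QReg Λ.n₁) (hx : Λ.XGood x) (y : QReg Λ.k) (yv pv : ℕ) :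
    PXor.pairStr (PXor.regs Λ.Wd_pos Λ.fs₄ (tri x y (Λ.yp yv pv))) =
      peE (Layout.bitsLE yv Λ.kap, (List.ofFn y, (Layout.bitsLE Λ.Nmod (Λ.kap + 1), Layout.bitsLE Λ.Bper Λ.wB))) := by
  rw [Λ.regs_fs₄ x hx]; rfl

/-- The pair string read by the un-move block is the code its machine expects. [folklore] -/
theorem pairStr_regs_fs₅ (x : QReg Λ.n₁) (hx : Λ.XGood x) (y : QReg Λ.k) (yv pv : ℕ) :
    PXor.pairStr (PXor.regs Λ.Wd_pos Λ.fs₅ (tri x y (Λ.yp yv pv))) =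
      peE (Layout.bitsLE pv Λ.kap, (List.ofFn y, (Layout.bitsLE Λ.Nmod (Λ.kap + 1), Layout.bitsLE Λ.Bper Λ.wB))) := by
  rw [Λ.regs_fs₅ x hx]; rfl

/-- `N = 2^κ ≥ 8`, `N < 2^{κ+1}`, `2B < 2^{2B+1}`. [folklore] -/
theorem size_facts : 8 ≤ Λ.Nmod ∧ Λ.Nmod % 2 ^ (Λ.kap + 1) = Λ.Nmod ∧ Λ.Bper % 2 ^ Λ.wB = Λ.Bper := by
  refine ⟨?_, Nat.mod_eq_of_lt (by unfold Nmod; exact Nat.pow_lt_pow_right (by norm_num) (by omega)),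
    Nat.mod_eq_of_lt (by unfold wB; exact Nat.lt_two_pow_self.trans (Nat.pow_lt_pow_right (by norm_num) (by omega)))⟩
  unfold Nmod kap
  calc (8 : ℕ) = 2 ^ 3 := by norm_num
    _ ≤ 2 ^ (Λ.lam + Λ.n + 3) := Nat.pow_le_pow_right (by norm_num) (by omega)

/-- The block area `[as, top)` of each `PXor` block is clean on a good three-part label. [folklore] -/
theorem clean_of_XGood {x : QReg Λ.n₁} (hx : Λ.XGood x) (y : QReg Λ.k) (ρ : QReg (Λ.kap + Λ.kap)) {T : ℕ} (hT : T ≤ Λ.n₁) :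
    ∀ q, Λ.as ≤ q → q < T → tri x y ρ (finOf Λ.Wd Λ.Wd_pos q) = false := by
  intro q h1 h2
  rw [show finOf Λ.Wd Λ.Wd_pos q = Λ.fin q from rfl, Λ.tri_fin_of_lt _ _ _ (by omega)]
  exact hx.area q (by omega) h1

/-- The block area of each `PXor` block is clean on a three-part label whose first part has a clean area. [folklore] -/
theorem clean_of_XGood' {x : QReg Λ.n₁} (hx : ∀ q (hq : q < Λ.n₁), Λ.as ≤ q → x ⟨q, hq⟩ = false) (y : QReg Λ.k)
    (ρ : QReg (Λ.kap + Λ.kap)) {T : ℕ} (hT : T ≤ Λ.n₁) :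
    ∀ q, Λ.as ≤ q → q < T → tri x y ρ (finOf Λ.Wd Λ.Wd_pos q) = false := by
  intro q h1 h2
  rw [show finOf Λ.Wd Λ.Wd_pos q = Λ.fin q from rfl, Λ.tri_fin_of_lt _ _ _ (by omega)]
  exact hx q (by omega) h1

/-- **`A` on a good label: move `Y` to `P`, shifted by the weighted exponent of the tests modulo `N`,
and clear `Y`.** [cite: Kitaev1995, §3 Lemma 10 (U^{[0,r]})] -/
theorem A_good (x : QReg Λ.n₁) (hx : Λ.XGood x) (y : QReg Λ.k) {yv : ℕ} (hyv : yv < Λ.Nmod) :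
    Λ.A x y (Λ.yp yv 0) = Λ.yp 0 ((yv + weightedExp Λ.Bper (List.ofFn y)) % Λ.Nmod) := by
  obtain ⟨h8, hNm, hBm⟩ := Λ.size_facts
  have hN2 : 2 ≤ Λ.Nmod := by omega
  have hyvm : yv % 2 ^ Λ.kap = yv := Nat.mod_eq_of_lt hyv
  set pv := peAddVal yv (List.ofFn y) Λ.Nmod Λ.Bper with hpv
  have hpvlt : pv < Λ.Nmod := Nat.mod_lt _ (by omega)
  have hpvm : pv % 2 ^ Λ.kap = pv := Nat.mod_eq_of_lt hpvlt
  set z := tri x y (Λ.yp yv 0) with hz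
  -- stage 4: the move-and-add block
  have hfn₄ : mach₄.fn (PXor.pairStr (PXor.regs Λ.Wd_pos Λ.fs₄ z)) = natE pv := by
    rw [hz, Λ.pairStr_regs_fs₄ x hx, mach₄, Mach.ofCodeFP_fn]
    simp only [bitsToNat_bitsLE, hyvm, hNm, hBm, hpv]
  have hM₄ := mach₄.spec (PXor.pairStr (PXor.regs Λ.Wd_pos Λ.fs₄ z))
  rw [hfn₄] at hM₄
  have htop₄ : PXor.top mach₄.e mach₄.M Λ.as Λ.fs₄ ≤ Λ.n₁ := by rw [Λ.top_eq Λ.length_slots_fs.2.2.2.1]; exact Λ.tops_le.2.2.2.1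
  set z₄ := clEval (PXor.ops Λ.Wd_pos mach₄.e mach₄.M Λ.as Λ.fs₄ Λ.kap Λ.P) z with hz₄
  have hz₄eq : z₄ = tri x y (Λ.yp yv pv) := by
    refine Λ.eq_tri_of_parts (ρ := Λ.yp yv 0) (fun q hq => ?_) (fun l => ?_)
    · rw [hz₄, hz]
      refine PXor.clEval_ops_of_ne Λ.geom₄ _ q fun j hj h => ?_
      have := congrArg Fin.val h
      rw [CleanXor.tgt, val_finOf_of_lt _ (Λ.P_lt_Wd hj)] at this
      simp only [P] at this; omega
    · by_cases hl : (l : ℕ) < Λ.kap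
      · have hne : ∀ j, j < Λ.kap → Fin.natAdd Λ.n₁ (Fin.natAdd Λ.k l) ≠ CleanXor.tgt Λ.Wd_pos Λ.P j := fun j hj h => by
          have := congrArg Fin.val h
          rw [CleanXor.tgt, val_finOf_of_lt _ (Λ.P_lt_Wd hj)] at this
          simp only [P, Fin.natAdd] at this; omega
        rw [hz₄, PXor.clEval_ops_of_ne Λ.geom₄ _ _ hne, hz, tri_work]
        simp [yp, hl]
      · obtain ⟨j, hj, hlj⟩ : ∃ j, j < Λ.kap ∧ (l : ℕ) = Λ.kap + j := ⟨l - Λ.kap, by omega, by omega⟩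
        have hlw : Fin.natAdd Λ.n₁ (Fin.natAdd Λ.k l) = CleanXor.tgt Λ.Wd_pos Λ.P j := by
          rw [CleanXor.tgt, show finOf Λ.Wd Λ.Wd_pos (Λ.P j) = Λ.fin (Λ.P j) from rfl, Λ.fin_P_eq hj]
          congr 2; exact Fin.ext hlj
        rw [hlw, hz₄, PXor.clEval_ops_target Λ.geom₄ z (Λ.clean_of_XGood hx _ _ htop₄) (natE pv) hM₄ hj, ← hlw, hz, tri_work,
          decide_getElem?_natE]
        simp [yp, hlj]
  -- stage 5: the un-move block
  have hfn₅ : mach₅.fn (PXor.pairStr (PXor.regs Λ.Wd_pos Λ.fs₅ z₄)) = natE yv := by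
    rw [hz₄eq, Λ.pairStr_regs_fs₅ x hx, mach₅, Mach.ofCodeFP_fn]
    simp only [bitsToNat_bitsLE, hpvm, hNm, hBm]
    rw [hpv, peSubVal_peAddVal hyv]
  have hM₅ := mach₅.spec (PXor.pairStr (PXor.regs Λ.Wd_pos Λ.fs₅ z₄))
  rw [hfn₅] at hM₅
  have htop₅ : PXor.top mach₅.e mach₅.M Λ.as Λ.fs₅ ≤ Λ.n₁ := by rw [Λ.top_eq Λ.length_slots_fs.2.2.2.2]; exact Λ.tops_le.2.2.2.2
  have hz₅eq : clEval (PXor.ops Λ.Wd_pos mach₅.e mach₅.M Λ.as Λ.fs₅ Λ.kap Λ.Y) z₄ = tri x y (Λ.yp 0 pv) := by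
    refine Λ.eq_tri_of_parts (ρ := Λ.yp yv pv) (fun q hq => ?_) (fun l => ?_)
    · rw [hz₄eq]
      refine PXor.clEval_ops_of_ne Λ.geom₅ _ q fun j hj h => ?_
      have := congrArg Fin.val h
      rw [CleanXor.tgt, val_finOf_of_lt _ (Λ.Y_lt_Wd hj)] at this
      simp only [Y] at this; omega
    · by_cases hl : (l : ℕ) < Λ.kap
      · have hlw : Fin.natAdd Λ.n₁ (Fin.natAdd Λ.k l) = CleanXor.tgt Λ.Wd_pos Λ.Y l := by
          rw [CleanXor.tgt, show finOf Λ.Wd Λ.Wd_pos (Λ.Y l) = Λ.fin (Λ.Y l) from rfl, Λ.fin_Y_eq hl]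
        rw [hlw, PXor.clEval_ops_target Λ.geom₅ z₄ (by rw [hz₄eq]; exact Λ.clean_of_XGood hx _ _ htop₅) (natE yv) hM₅ hl,
          ← hlw, hz₄eq, tri_work, decide_getElem?_natE]
        simp [yp, hl]
      · have hne : ∀ j, j < Λ.kap → Fin.natAdd Λ.n₁ (Fin.natAdd Λ.k l) ≠ CleanXor.tgt Λ.Wd_pos Λ.Y j := fun j hj h => by
          have := congrArg Fin.val h
          rw [CleanXor.tgt, val_finOf_of_lt _ (Λ.Y_lt_Wd hj)] at this
          simp only [Y, Fin.natAdd] at this; omega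
        rw [PXor.clEval_ops_of_ne Λ.geom₅ _ _ hne, hz₄eq, tri_work]
        simp [yp, hl]
  -- read off the work part
  funext l
  rw [A, Vmap, Function.comp_apply, ← hz, ← hz₄, hz₅eq, tri_work, hpv, peAddVal_eq hN2]

/-! ### The constants stage -/

/-- The bit the constants stage writes at wire `i`. [folklore] -/
def constBit (d : Data) (i : ℕ) : Bool :=
  ((decide (Λ.Preg 0 ≤ i ∧ i < Λ.Preg 0 + Λ.n) && (Layout.bitsLE d.p Λ.n).getD (i - Λ.Preg 0) false) ^^
    (decide (Λ.Rreg 0 ≤ i ∧ i < Λ.Rreg 0 + Λ.n) && (Layout.bitsLE d.r Λ.n).getD (i - Λ.Rreg 0) false)) ^^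
    (decide (Λ.CPreg 0 ≤ i ∧ i < Λ.CPreg 0 + 2) && (Layout.bitsLE d.cp 2).getD (i - Λ.CPreg 0) false) ^^
    (decide (Λ.T2n 0 ≤ i ∧ i < Λ.T2n 0 + (Λ.n + 1)) && (Layout.bitsLE (2 ^ Λ.n) (Λ.n + 1)).getD (i - Λ.T2n 0) false) ^^
    (decide (Λ.Nreg 0 ≤ i ∧ i < Λ.Nreg 0 + (Λ.kap + 1)) && (Layout.bitsLE Λ.Nmod (Λ.kap + 1)).getD (i - Λ.Nreg 0) false) ^^
    (decide (Λ.BPreg 0 ≤ i ∧ i < Λ.BPreg 0 + Λ.wB) && (Layout.bitsLE Λ.Bper Λ.wB).getD (i - Λ.BPreg 0) false)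

/-- The bit of the first part at wire `i` apart from the coins: the input bits of `p`, `r` and the
constants `2ⁿ, N, 2B` (`constBit` without the coin term). [folklore] -/
def notBit (d : Data) (i : ℕ) : Bool :=
  ((decide (Λ.Preg 0 ≤ i ∧ i < Λ.Preg 0 + Λ.n) && (Layout.bitsLE d.p Λ.n).getD (i - Λ.Preg 0) false) ^^
    (decide (Λ.Rreg 0 ≤ i ∧ i < Λ.Rreg 0 + Λ.n) && (Layout.bitsLE d.r Λ.n).getD (i - Λ.Rreg 0) false)) ^^
    (decide (Λ.T2n 0 ≤ i ∧ i < Λ.T2n 0 + (Λ.n + 1)) && (Layout.bitsLE (2 ^ Λ.n) (Λ.n + 1)).getD (i - Λ.T2n 0) false) ^^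
    (decide (Λ.Nreg 0 ≤ i ∧ i < Λ.Nreg 0 + (Λ.kap + 1)) && (Layout.bitsLE Λ.Nmod (Λ.kap + 1)).getD (i - Λ.Nreg 0) false) ^^
    (decide (Λ.BPreg 0 ≤ i ∧ i < Λ.BPreg 0 + Λ.wB) && (Layout.bitsLE Λ.Bper Λ.wB).getD (i - Λ.BPreg 0) false)

/-- The input bit at wire `i`: the bits of `p` on `[0, n)`, of `r` on `[n, 2n)`. [folklore] -/
def inBit (d : Data) (i : ℕ) : Bool :=
  (decide (Λ.Preg 0 ≤ i ∧ i < Λ.Preg 0 + Λ.n) && (Layout.bitsLE d.p Λ.n).getD (i - Λ.Preg 0) false) ^^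
    (decide (Λ.Rreg 0 ≤ i ∧ i < Λ.Rreg 0 + Λ.n) && (Layout.bitsLE d.r Λ.n).getD (i - Λ.Rreg 0) false)

/-- The bit the `X` gates of the constants stage write at wire `i`. [folklore] -/
def notsBit (i : ℕ) : Bool :=
  ((decide (Λ.T2n 0 ≤ i ∧ i < Λ.T2n 0 + (Λ.n + 1)) && (Layout.bitsLE (2 ^ Λ.n) (Λ.n + 1)).getD (i - Λ.T2n 0) false) ^^
    (decide (Λ.Nreg 0 ≤ i ∧ i < Λ.Nreg 0 + (Λ.kap + 1)) && (Layout.bitsLE Λ.Nmod (Λ.kap + 1)).getD (i - Λ.Nreg 0) false)) ^^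
    (decide (Λ.BPreg 0 ≤ i ∧ i < Λ.BPreg 0 + Λ.wB) && (Layout.bitsLE Λ.Bper Λ.wB).getD (i - Λ.BPreg 0) false)

/-- `notBit = inBit ⊕ notsBit`. [folklore] -/
theorem notBit_eq_inBit_xor (d : Data) (i : ℕ) : Λ.notBit d i = (Λ.inBit d i ^^ Λ.notsBit i) := by
  unfold notBit inBit notsBit
  generalize (decide (Λ.Preg 0 ≤ i ∧ i < Λ.Preg 0 + Λ.n) && (Layout.bitsLE d.p Λ.n).getD (i - Λ.Preg 0) false) = a
  generalize (decide (Λ.Rreg 0 ≤ i ∧ i < Λ.Rreg 0 + Λ.n) && (Layout.bitsLE d.r Λ.n).getD (i - Λ.Rreg 0) false) = b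
  generalize (decide (Λ.T2n 0 ≤ i ∧ i < Λ.T2n 0 + (Λ.n + 1)) && (Layout.bitsLE (2 ^ Λ.n) (Λ.n + 1)).getD (i - Λ.T2n 0) false) = e
  generalize (decide (Λ.Nreg 0 ≤ i ∧ i < Λ.Nreg 0 + (Λ.kap + 1)) && (Layout.bitsLE Λ.Nmod (Λ.kap + 1)).getD (i - Λ.Nreg 0) false) = g
  generalize (decide (Λ.BPreg 0 ≤ i ∧ i < Λ.BPreg 0 + Λ.wB) && (Layout.bitsLE Λ.Bper Λ.wB).getD (i - Λ.BPreg 0) false) = h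
  cases a <;> cases b <;> cases e <;> cases g <;> cases h <;> rfl

/-- **Semantics of the constant gates**: wire `i` is XORed with `notsBit i`. [folklore] -/
theorem clEval_constOps (w : ℕ → Bool) (i : ℕ) : clEval Λ.constOps w i = (w i ^^ Λ.notsBit i) := by
  simp only [constOps, clEval_append, clEval_notsV_apply, notsBit, Layout.bitsLE, List.length_map, List.length_range,
    Bool.xor_assoc]

/-- `notsBit` vanishes off the three constant registers, in particular below `cs` and from `as` on. [folklore] -/
theorem notsBit_of_not {i : ℕ} (hi : i < Λ.cs + 2 ∨ Λ.as ≤ i) : Λ.notsBit i = false := by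
  have has : Λ.as = Λ.cs + Λ.n + Λ.kap + 4 + Λ.wB := rfl
  unfold notsBit
  rw [decide_eq_false (show ¬(Λ.T2n 0 ≤ i ∧ i < Λ.T2n 0 + (Λ.n + 1)) by unfold T2n; omega),
    decide_eq_false (show ¬(Λ.Nreg 0 ≤ i ∧ i < Λ.Nreg 0 + (Λ.kap + 1)) by unfold Nreg; omega),
    decide_eq_false (show ¬(Λ.BPreg 0 ≤ i ∧ i < Λ.BPreg 0 + Λ.wB) by unfold BPreg; omega)]
  simp

/-- `constBit` is `notBit` with the coin term of `CPreg`. [folklore] -/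
theorem constBit_eq_notBit_xor (d : Data) (i : ℕ) : Λ.constBit d i =
    (Λ.notBit d i ^^ (decide (Λ.CPreg 0 ≤ i ∧ i < Λ.CPreg 0 + 2) && (Layout.bitsLE d.cp 2).getD (i - Λ.CPreg 0) false)) := by
  unfold constBit notBit
  generalize (decide (Λ.Preg 0 ≤ i ∧ i < Λ.Preg 0 + Λ.n) && (Layout.bitsLE d.p Λ.n).getD (i - Λ.Preg 0) false) = a
  generalize (decide (Λ.Rreg 0 ≤ i ∧ i < Λ.Rreg 0 + Λ.n) && (Layout.bitsLE d.r Λ.n).getD (i - Λ.Rreg 0) false) = b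
  generalize (decide (Λ.CPreg 0 ≤ i ∧ i < Λ.CPreg 0 + 2) && (Layout.bitsLE d.cp 2).getD (i - Λ.CPreg 0) false) = c₃
  generalize (decide (Λ.T2n 0 ≤ i ∧ i < Λ.T2n 0 + (Λ.n + 1)) && (Layout.bitsLE (2 ^ Λ.n) (Λ.n + 1)).getD (i - Λ.T2n 0) false) = e
  generalize (decide (Λ.Nreg 0 ≤ i ∧ i < Λ.Nreg 0 + (Λ.kap + 1)) && (Layout.bitsLE Λ.Nmod (Λ.kap + 1)).getD (i - Λ.Nreg 0) false) = g
  generalize (decide (Λ.BPreg 0 ≤ i ∧ i < Λ.BPreg 0 + Λ.wB) && (Layout.bitsLE Λ.Bper Λ.wB).getD (i - Λ.BPreg 0) false) = h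
  cases a <;> cases b <;> cases c₃ <;> cases e <;> cases g <;> cases h <;> rfl

/-- Entry `i` of `bitsLE v w`. [folklore] -/
theorem getD_bitsLE (v w i : ℕ) (hi : i < w) : (Layout.bitsLE v w).getD i false = v.testBit i := by
  unfold Layout.bitsLE
  rw [List.getD_eq_getElem _ _ (by simpa using hi)]
  simp

/-- The six range tests of `constBit`, decided. [folklore] -/
theorem constBit_eq (d : Data) (i : ℕ) {b₁ b₂ b₃ b₄ b₅ b₆ : Bool}
    (e₁ : decide (Λ.Preg 0 ≤ i ∧ i < Λ.Preg 0 + Λ.n) = b₁) (e₂ : decide (Λ.Rreg 0 ≤ i ∧ i < Λ.Rreg 0 + Λ.n) = b₂)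
    (e₃ : decide (Λ.CPreg 0 ≤ i ∧ i < Λ.CPreg 0 + 2) = b₃) (e₄ : decide (Λ.T2n 0 ≤ i ∧ i < Λ.T2n 0 + (Λ.n + 1)) = b₄)
    (e₅ : decide (Λ.Nreg 0 ≤ i ∧ i < Λ.Nreg 0 + (Λ.kap + 1)) = b₅) (e₆ : decide (Λ.BPreg 0 ≤ i ∧ i < Λ.BPreg 0 + Λ.wB) = b₆) :
    Λ.constBit d i =
      (((b₁ && (Layout.bitsLE d.p Λ.n).getD (i - Λ.Preg 0) false) ^^ (b₂ && (Layout.bitsLE d.r Λ.n).getD (i - Λ.Rreg 0) false)) ^^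
        (b₃ && (Layout.bitsLE d.cp 2).getD (i - Λ.CPreg 0) false) ^^
        (b₄ && (Layout.bitsLE (2 ^ Λ.n) (Λ.n + 1)).getD (i - Λ.T2n 0) false) ^^
        (b₅ && (Layout.bitsLE Λ.Nmod (Λ.kap + 1)).getD (i - Λ.Nreg 0) false) ^^
        (b₆ && (Layout.bitsLE Λ.Bper Λ.wB).getD (i - Λ.BPreg 0) false)) := by
  unfold constBit; rw [e₁, e₂, e₃, e₄, e₅, e₆]

/-- The constants stage does not touch wires before the constants. [folklore] -/
theorem constBit_of_lt_cs (d : Data) {i : ℕ} (hi : i < Λ.cs) (hℓ : Λ.ℓ ≤ i) : Λ.constBit d i = false := by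
  have hcsv : Λ.cs = Λ.ℓ + 3 + Λ.n + Λ.lam := rfl
  have hℓv : Λ.ℓ = 2 * Λ.n := rfl
  rw [Λ.constBit_eq d i (decide_eq_false (by simp only [Preg]; omega)) (decide_eq_false (by simp only [Rreg]; omega))
    (decide_eq_false (by simp only [CPreg]; omega)) (decide_eq_false (by simp only [T2n]; omega))
    (decide_eq_false (by simp only [Nreg]; omega)) (decide_eq_false (by simp only [BPreg]; omega))]
  simp

/-- The constants stage does not touch the area and beyond. [folklore] -/
theorem constBit_of_as_le (d : Data) {i : ℕ} (hi : Λ.as ≤ i) : Λ.constBit d i = false := by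
  have hcsv : Λ.cs = Λ.ℓ + 3 + Λ.n + Λ.lam := rfl
  have hℓv : Λ.ℓ = 2 * Λ.n := rfl
  have has : Λ.as = Λ.cs + Λ.n + Λ.kap + 4 + Λ.wB := rfl
  rw [Λ.constBit_eq d i (decide_eq_false (by simp only [Preg]; omega)) (decide_eq_false (by simp only [Rreg]; omega))
    (decide_eq_false (by simp only [CPreg]; omega)) (decide_eq_false (by simp only [T2n]; omega))
    (decide_eq_false (by simp only [Nreg]; omega)) (decide_eq_false (by simp only [BPreg]; omega))]
  simp

/-- The constants stage writes `N` into its register. [folklore] -/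
theorem constBit_Nreg (d : Data) {i : ℕ} (hi : i < Λ.kap + 1) : Λ.constBit d (Λ.Nreg i) = Λ.Nmod.testBit i := by
  have hcsv : Λ.cs = Λ.ℓ + 3 + Λ.n + Λ.lam := rfl
  have hℓv : Λ.ℓ = 2 * Λ.n := rfl
  rw [Λ.constBit_eq d _ (decide_eq_false (by simp only [Preg, Nreg]; omega)) (decide_eq_false (by simp only [Rreg, Nreg]; omega))
    (decide_eq_false (by simp only [CPreg, Nreg]; omega)) (decide_eq_false (by simp only [T2n, Nreg]; omega))
    (decide_eq_true (by simp only [Nreg]; omega)) (decide_eq_false (by simp only [BPreg, Nreg]; omega))]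
  simp only [Bool.false_and, Bool.true_and, Bool.false_xor, Bool.xor_false]
  rw [show Λ.Nreg i - Λ.Nreg 0 = i by simp only [Nreg]; omega, getD_bitsLE _ _ _ hi]

/-- The constants stage writes `2B` into its register. [folklore] -/
theorem constBit_BPreg (d : Data) {i : ℕ} (hi : i < Λ.wB) : Λ.constBit d (Λ.BPreg i) = Λ.Bper.testBit i := by
  have hcsv : Λ.cs = Λ.ℓ + 3 + Λ.n + Λ.lam := rfl
  have hℓv : Λ.ℓ = 2 * Λ.n := rfl
  rw [Λ.constBit_eq d _ (decide_eq_false (by simp only [Preg, BPreg]; omega)) (decide_eq_false (by simp only [Rreg, BPreg]; omega))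
    (decide_eq_false (by simp only [CPreg, BPreg]; omega)) (decide_eq_false (by simp only [T2n, BPreg]; omega))
    (decide_eq_false (by simp only [Nreg, BPreg]; omega)) (decide_eq_true (by simp only [BPreg]; omega))]
  simp only [Bool.false_and, Bool.true_and, Bool.false_xor, Bool.xor_false]
  rw [show Λ.BPreg i - Λ.BPreg 0 = i by simp only [BPreg]; omega, getD_bitsLE _ _ _ hi]

/-- The constants stage writes `p` into its register. [folklore] -/
theorem constBit_Preg (d : Data) {i : ℕ} (hi : i < Λ.n) : Λ.constBit d (Λ.Preg i) = d.p.testBit i := by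
  have hcsv : Λ.cs = Λ.ℓ + 3 + Λ.n + Λ.lam := rfl
  have hℓv : Λ.ℓ = 2 * Λ.n := rfl
  rw [Λ.constBit_eq d _ (decide_eq_true (by simp only [Preg]; omega)) (decide_eq_false (by simp only [Rreg, Preg]; omega))
    (decide_eq_false (by simp only [CPreg, Preg]; omega)) (decide_eq_false (by simp only [T2n, Preg]; omega))
    (decide_eq_false (by simp only [Nreg, Preg]; omega)) (decide_eq_false (by simp only [BPreg, Preg]; omega))]
  simp only [Bool.false_and, Bool.true_and, Bool.xor_false]
  rw [show Λ.Preg i - Λ.Preg 0 = i by simp only [Preg]; omega, getD_bitsLE _ _ _ hi]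

/-- The constants stage writes `r` into its register. [folklore] -/
theorem constBit_Rreg (d : Data) {i : ℕ} (hi : i < Λ.n) : Λ.constBit d (Λ.Rreg i) = d.r.testBit i := by
  have hcsv : Λ.cs = Λ.ℓ + 3 + Λ.n + Λ.lam := rfl
  have hℓv : Λ.ℓ = 2 * Λ.n := rfl
  rw [Λ.constBit_eq d _ (decide_eq_false (by simp only [Preg, Rreg]; omega)) (decide_eq_true (by simp only [Rreg]; omega))
    (decide_eq_false (by simp only [CPreg, Rreg]; omega)) (decide_eq_false (by simp only [T2n, Rreg]; omega))
    (decide_eq_false (by simp only [Nreg, Rreg]; omega)) (decide_eq_false (by simp only [BPreg, Rreg]; omega))]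
  simp only [Bool.false_and, Bool.true_and, Bool.false_xor, Bool.xor_false]
  rw [show Λ.Rreg i - Λ.Rreg 0 = i by simp only [Rreg]; omega, getD_bitsLE _ _ _ hi]

/-- The constants stage writes `c'` into its register. [folklore] -/
theorem constBit_CPreg (d : Data) {i : ℕ} (hi : i < 2) : Λ.constBit d (Λ.CPreg i) = d.cp.testBit i := by
  have hcsv : Λ.cs = Λ.ℓ + 3 + Λ.n + Λ.lam := rfl
  have hℓv : Λ.ℓ = 2 * Λ.n := rfl
  rw [Λ.constBit_eq d _ (decide_eq_false (by simp only [Preg, CPreg]; omega)) (decide_eq_false (by simp only [Rreg, CPreg]; omega))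
    (decide_eq_true (by simp only [CPreg]; omega)) (decide_eq_false (by simp only [T2n, CPreg]; omega))
    (decide_eq_false (by simp only [Nreg, CPreg]; omega)) (decide_eq_false (by simp only [BPreg, CPreg]; omega))]
  simp only [Bool.false_and, Bool.true_and, Bool.false_xor, Bool.xor_false]
  rw [show Λ.CPreg i - Λ.CPreg 0 = i by simp only [CPreg]; omega, getD_bitsLE _ _ _ hi]

/-- The constants stage writes `2ⁿ` into its register. [folklore] -/
theorem constBit_T2n (d : Data) {i : ℕ} (hi : i < Λ.n + 1) : Λ.constBit d (Λ.T2n i) = (2 ^ Λ.n).testBit i := by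
  have hcsv : Λ.cs = Λ.ℓ + 3 + Λ.n + Λ.lam := rfl
  have hℓv : Λ.ℓ = 2 * Λ.n := rfl
  rw [Λ.constBit_eq d _ (decide_eq_false (by simp only [Preg, T2n]; omega)) (decide_eq_false (by simp only [Rreg, T2n]; omega))
    (decide_eq_false (by simp only [CPreg, T2n]; omega)) (decide_eq_true (by simp only [T2n]; omega))
    (decide_eq_false (by simp only [Nreg, T2n]; omega)) (decide_eq_false (by simp only [BPreg, T2n]; omega))]
  simp only [Bool.false_and, Bool.true_and, Bool.false_xor, Bool.xor_false]
  rw [show Λ.T2n i - Λ.T2n 0 = i by simp only [T2n]; omega, getD_bitsLE _ _ _ hi]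

/-- The bit of the first part at wire `q` in the component `d`: the coin `τ` holds `d.im`, the
constant registers and the coins `CPreg` hold `constBit d`. [folklore] -/
def cxv (d : Data) (q : ℕ) : Bool := if q = Λ.tau then d.im else Λ.constBit d q

/-- **The first part after the constants-and-coins stage**, in the component `d`. [folklore] -/
def cx (d : Data) : QReg Λ.n₁ := fun q => Λ.cxv d q

/-- `cx` off the coin `τ`. [folklore] -/
theorem cx_of_ne_tau (d : Data) {q : ℕ} (hq : q < Λ.n₁) (h : q ≠ Λ.tau) : Λ.cx d ⟨q, hq⟩ = Λ.constBit d q := if_neg h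

/-- `τ < c ≤ …`: every wire from the control on is not `τ`. [folklore] -/
theorem tau_lt_of_c_le {q : ℕ} (h : Λ.c ≤ q) : Λ.tau < q := lt_of_lt_of_le Λ.tau_lt_c h

/-- `τ` precedes the constants. [folklore] -/
theorem tau_lt_cs : Λ.tau < Λ.cs := by unfold tau cs; omega

/-- `τ` is inside the first part. [folklore] -/
theorem tau_lt_n₁ : Λ.tau < Λ.n₁ := by have := Λ.tau_lt_c; have := Λ.c_lt_as; have := Λ.as_le_n₁; omega

/-- `cx` on the coin `τ`. [folklore] -/
theorem cx_tau (d : Data) : Λ.cx d ⟨Λ.tau, Λ.tau_lt_n₁⟩ = d.im := if_pos rfl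

/-- `cx` before the constants (off `τ`) is clean. [folklore] -/
theorem cx_of_lt_cs (d : Data) {q : ℕ} (hlt : q < Λ.cs) (ht : Λ.tau < q) (hq : q < Λ.n₁) : Λ.cx d ⟨q, hq⟩ = false := by
  rw [Λ.cx_of_ne_tau d hq (Nat.ne_of_gt ht)]; exact Λ.constBit_of_lt_cs d hlt (by unfold tau at ht; omega)

/-- `cx` on the area and beyond is clean. [folklore] -/
theorem cx_of_as_le (d : Data) {q : ℕ} (hle : Λ.as ≤ q) (hq : q < Λ.n₁) : Λ.cx d ⟨q, hq⟩ = false := by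
  have := Λ.tau_lt_cs; have : Λ.cs ≤ Λ.as := by unfold as; omega
  rw [Λ.cx_of_ne_tau d hq (by omega)]; exact Λ.constBit_of_as_le d hle

/-- `cx` on the register of `p`. [folklore] -/
theorem cx_Preg (d : Data) {i : ℕ} (hi : i < Λ.n) (h : Λ.Preg i < Λ.n₁) : Λ.cx d ⟨Λ.Preg i, h⟩ = d.p.testBit i := by
  rw [Λ.cx_of_ne_tau d h (by unfold Preg tau ℓ; omega)]; exact Λ.constBit_Preg d hi
/-- `cx` on the register of `r`. [folklore] -/
theorem cx_Rreg (d : Data) {i : ℕ} (hi : i < Λ.n) (h : Λ.Rreg i < Λ.n₁) : Λ.cx d ⟨Λ.Rreg i, h⟩ = d.r.testBit i := by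
  rw [Λ.cx_of_ne_tau d h (by unfold Rreg tau ℓ; omega)]; exact Λ.constBit_Rreg d hi
/-- `cx` on the coins `CPreg`. [folklore] -/
theorem cx_CPreg (d : Data) {i : ℕ} (hi : i < 2) (h : Λ.CPreg i < Λ.n₁) : Λ.cx d ⟨Λ.CPreg i, h⟩ = d.cp.testBit i := by
  have := Λ.tau_lt_cs; rw [Λ.cx_of_ne_tau d h (by unfold CPreg; omega)]; exact Λ.constBit_CPreg d hi
/-- `cx` on the register of `2ⁿ`. [folklore] -/
theorem cx_T2n (d : Data) {i : ℕ} (hi : i < Λ.n + 1) (h : Λ.T2n i < Λ.n₁) : Λ.cx d ⟨Λ.T2n i, h⟩ = (2 ^ Λ.n).testBit i := by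
  have := Λ.tau_lt_cs; rw [Λ.cx_of_ne_tau d h (by unfold T2n; omega)]; exact Λ.constBit_T2n d hi
/-- `cx` on the register of `N`. [folklore] -/
theorem cx_Nreg (d : Data) {i : ℕ} (hi : i < Λ.kap + 1) (h : Λ.Nreg i < Λ.n₁) : Λ.cx d ⟨Λ.Nreg i, h⟩ = Λ.Nmod.testBit i := by
  have := Λ.tau_lt_cs; rw [Λ.cx_of_ne_tau d h (by unfold Nreg; omega)]; exact Λ.constBit_Nreg d hi
/-- `cx` on the register of `2B`. [folklore] -/
theorem cx_BPreg (d : Data) {i : ℕ} (hi : i < Λ.wB) (h : Λ.BPreg i < Λ.n₁) : Λ.cx d ⟨Λ.BPreg i, h⟩ = Λ.Bper.testBit i := by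
  have := Λ.tau_lt_cs; rw [Λ.cx_of_ne_tau d h (by unfold BPreg; omega)]; exact Λ.constBit_BPreg d hi

/-- The first part of a component is good for `V`. [folklore] -/
theorem cx_good (d : Data) : Λ.XGood (Λ.cx d) where
  area := fun _ hq hle => Λ.cx_of_as_le d hle hq
  nreg := fun _ hi => Λ.cx_Nreg d hi _
  bpreg := fun _ hi => Λ.cx_BPreg d hi _

/-- A three-part label with clean tests and work part vanishes beyond the first part. [folklore] -/
theorem tri_zero_zero_apply_of_le (x : QReg Λ.n₁) (q : Fin Λ.Wd) (hq : Λ.n₁ ≤ (q : ℕ)) :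
    tri x (fun _ : Fin Λ.k => false) (fun _ : Fin (Λ.kap + Λ.kap) => false) q = false := by
  induction q using Fin.addCases with
  | left i => exact absurd hq (by simp)
  | right i =>
    induction i using Fin.addCases with
    | left j => exact tri_coinWire x (fun _ => false) (fun _ => false) j
    | right l => exact tri_work x (fun _ => false) (fun _ => false) l

/-! ### Hadamard gates on a contiguous register of the first part -/

/-- Overwrite the contiguous register `[p₀, p₀ + w)` of the first part with the bits of `s`. [folklore] -/
def setReg (p₀ w : ℕ) (x : QReg Λ.n₁) (s : ℕ) : QReg Λ.n₁ :=
  fun q => if p₀ ≤ (q : ℕ) ∧ (q : ℕ) < p₀ + w then s.testBit (q - p₀) else x q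

/-- `setReg` off the register. [folklore] -/
theorem setReg_of_not {p₀ w : ℕ} (x : QReg Λ.n₁) (s : ℕ) {q : Fin Λ.n₁} (hq : ¬(p₀ ≤ (q : ℕ) ∧ (q : ℕ) < p₀ + w)) :
    Λ.setReg p₀ w x s q = x q := by simp [setReg, hq]

/-- `setReg` on the register. [folklore] -/
theorem setReg_of_mem {p₀ w : ℕ} (x : QReg Λ.n₁) (s : ℕ) {i : ℕ} (hi : i < w) (h : p₀ + i < Λ.n₁) :
    Λ.setReg p₀ w x s ⟨p₀ + i, h⟩ = s.testBit i := by
  simp [setReg, hi]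

/-- The wires of a contiguous register of the first part, inside the block register. [folklore] -/
def regWires (p₀ w : ℕ) : List (Fin Λ.Wd) := (List.range w).map fun i => Λ.fin (p₀ + i)

/-- The register wires are pairwise distinct. [folklore] -/
theorem nodup_regWires {p₀ w : ℕ} (h : p₀ + w ≤ Λ.n₁) : (Λ.regWires p₀ w).Nodup := by
  refine List.Nodup.map_on (fun i hi j hj hij => ?_) List.nodup_range
  rw [List.mem_range] at hi hj
  have hW := Λ.n₁_le_Wd
  have := congrArg Fin.val hij
  rwa [fin, fin, val_finOf_of_lt _ (by omega), val_finOf_of_lt _ (by omega), Nat.add_left_cancel_iff] at this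

/-- Membership in the register wires, by value. [folklore] -/
theorem mem_regWires_iff {p₀ w : ℕ} (h : p₀ + w ≤ Λ.n₁) (q : Fin Λ.Wd) :
    q ∈ Λ.regWires p₀ w ↔ p₀ ≤ (q : ℕ) ∧ (q : ℕ) < p₀ + w := by
  have hW := Λ.n₁_le_Wd
  unfold regWires
  rw [List.mem_map]
  constructor
  · rintro ⟨i, hi, rfl⟩
    rw [List.mem_range] at hi
    rw [fin, val_finOf_of_lt _ (by omega)]; omega
  · rintro ⟨h1, h2⟩
    refine ⟨q - p₀, List.mem_range.2 (by omega), Fin.ext ?_⟩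
    rw [fin, val_finOf_of_lt _ (by omega)]; omega

/-- A number below `2ʷ` is determined by its `w` low bits. [folklore] -/
theorem eq_of_testBit_eq_of_lt {w s s' : ℕ} (hs : s < 2 ^ w) (hs' : s' < 2 ^ w)
    (h : ∀ i, i < w → s.testBit i = s'.testBit i) : s = s' := by
  refine Nat.eq_of_testBit_eq fun i => ?_
  by_cases hi : i < w
  · exact h i hi
  · rw [Nat.testBit_eq_false_of_lt (lt_of_lt_of_le hs (Nat.pow_le_pow_right (by norm_num) (by omega))),
      Nat.testBit_eq_false_of_lt (lt_of_lt_of_le hs' (Nat.pow_le_pow_right (by norm_num) (by omega)))]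

/-- The number read off `w` wires. [folklore] -/
theorem exists_val_of_bits (w : ℕ) (b : ℕ → Bool) : ∃ s, s < 2 ^ w ∧ ∀ i, i < w → s.testBit i = b i := by
  refine ⟨bitsToNat ((List.range w).map b), ?_, fun i hi => ?_⟩
  · have := bitsToNat_lt ((List.range w).map b)
    simpa using this
  · rw [testBit_bitsToNat, List.getD_eq_getElem _ _ (by simpa using hi)]
    simp

/-- **Hadamard gates on a clean contiguous register of the first part produce the uniform
superposition over its values.** [cite: NielsenChuang2010, §1.4.4 eq. (1.50)] -/
theorem hadamards_reg_mulVec {p₀ w : ℕ} (h : p₀ + w ≤ Λ.n₁) (x : QReg Λ.n₁)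
    (hx : ∀ i (hi : i < w), x ⟨p₀ + i, by omega⟩ = false) (y : QReg Λ.k) (ρ : QReg (Λ.kap + Λ.kap)) :
    (⟨(Λ.regWires p₀ w).map hOn⟩ : QCircuit cliffordT Λ.Wd).toMatrix 0 *ᵥ basisState (tri x y ρ) =
      invSqrt2 ^ w • ∑ s ∈ Finset.range (2 ^ w), basisState (tri (Λ.setReg p₀ w x s) y ρ) := by
  have hW := Λ.n₁_le_Wd
  have hws : ∀ i ∈ Λ.regWires p₀ w, tri x y ρ i = false := fun i hi => by
    obtain ⟨j, hj, rfl⟩ := List.mem_map.1 hi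
    rw [List.mem_range] at hj
    rw [Λ.tri_fin_of_lt _ _ _ (by omega)]
    exact hx j hj
  rw [hadamards_mulVec_basisState _ (Λ.nodup_regWires h) _ hws]
  have hlen : (Λ.regWires p₀ w).length = w := by simp [regWires]
  ext z
  simp only [Pi.smul_apply, Finset.sum_apply, basisState_apply, smul_eq_mul, hlen, Finset.sum_boole]
  -- the label `tri (setReg s) y ρ` agrees with `tri x y ρ` off the register
  have hoff : ∀ s (q : Fin Λ.Wd), q ∉ Λ.regWires p₀ w → tri (Λ.setReg p₀ w x s) y ρ q = tri x y ρ q := by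
    intro s q hq
    rw [Λ.mem_regWires_iff h] at hq
    by_cases hq1 : (q : ℕ) < Λ.n₁
    · rw [show q = Λ.fin q from Fin.ext (by rw [fin, val_finOf_of_lt _ q.isLt]), Λ.tri_fin_of_lt _ _ _ hq1,
        Λ.tri_fin_of_lt _ _ _ hq1, Λ.setReg_of_not _ _ (by simpa using hq)]
    · -- beyond the first part the two labels agree (tests and work part)
      induction q using Fin.addCases with
      | left i => simp at hq1
      | right i =>
        induction i using Fin.addCases with
        | left j => rw [show Fin.natAdd Λ.n₁ (Fin.castAdd _ j) = coinWire Λ.n₁ Λ.k _ j from rfl, tri_coinWire, tri_coinWire]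
        | right l => rw [tri_work, tri_work]
  -- on the register it reads the bits of `s`
  have hon : ∀ s i (hi : i < w), tri (Λ.setReg p₀ w x s) y ρ (Λ.fin (p₀ + i)) = s.testBit i := fun s i hi => by
    rw [Λ.tri_fin_of_lt _ _ _ (by omega), Λ.setReg_of_mem _ _ hi]
  by_cases hz : ∀ j, j ∉ Λ.regWires p₀ w → z j = tri x y ρ j
  · rw [if_pos hz]
    -- the unique value read off `z`
    obtain ⟨s₀, hs₀, hbits⟩ := exists_val_of_bits w fun i => z (Λ.fin (p₀ + i))
    have hzs₀ : tri (Λ.setReg p₀ w x s₀) y ρ = z := by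
      funext q
      by_cases hq : q ∈ Λ.regWires p₀ w
      · obtain ⟨i, hi, rfl⟩ := List.mem_map.1 hq
        rw [List.mem_range] at hi
        rw [hon s₀ i hi, hbits i hi]
      · rw [hoff s₀ q hq, hz q hq]
    have hfilter : (Finset.range (2 ^ w)).filter (fun s => z = tri (Λ.setReg p₀ w x s) y ρ) = {s₀} := by
      ext s
      simp only [Finset.mem_filter, Finset.mem_range, Finset.mem_singleton]
      constructor
      · rintro ⟨hs, hsz⟩
        refine eq_of_testBit_eq_of_lt hs hs₀ fun i hi => ?_
        rw [← hon s i hi, ← hon s₀ i hi, ← hsz, hzs₀]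
      · rintro rfl; exact ⟨hs₀, hzs₀.symm⟩
    rw [hfilter, Finset.card_singleton, Nat.cast_one, mul_one]
  · rw [if_neg hz]
    have hfilter : (Finset.range (2 ^ w)).filter (fun s => z = tri (Λ.setReg p₀ w x s) y ρ) = ∅ := by
      refine Finset.filter_false_of_mem fun s _ hsz => hz fun j hj => ?_
      rw [hsz, hoff s j hj]
    rw [hfilter, Finset.card_empty, Nat.cast_zero, mul_zero]

/-- Updating a first-part wire of a three-part label. [folklore] -/
theorem update_tri_fin (x : QReg Λ.n₁) (y : QReg Λ.k) (ρ : QReg (Λ.kap + Λ.kap)) {q : ℕ} (hq : q < Λ.n₁) (b : Bool) :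
    Function.update (tri x y ρ) (Λ.fin q) b = tri (Function.update x ⟨q, hq⟩ b) y ρ := by
  have hW := Λ.n₁_le_Wd
  refine Λ.eq_tri_of_parts (x := Function.update x ⟨q, hq⟩ b) (ρ := ρ) (fun w hw => ?_) (fun l => ?_)
  · by_cases hwq : w = Λ.fin q
    · subst hwq
      rw [Function.update_self, Λ.tri_fin_of_lt _ _ _ hq, Function.update_self]
    · rw [Function.update_of_ne hwq]
      by_cases hw1 : (w : ℕ) < Λ.n₁
      · have hwf : w = Λ.fin w := Fin.ext (by rw [fin, val_finOf_of_lt _ w.isLt])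
        rw [hwf, Λ.tri_fin_of_lt _ _ _ hw1, Λ.tri_fin_of_lt _ _ _ hw1, Function.update_of_ne]
        intro h
        apply hwq
        rw [hwf]
        have := congrArg Fin.val h
        simp only at this
        exact congrArg Λ.fin this
      · obtain ⟨j, rfl⟩ : ∃ j : Fin Λ.k, w = coinWire Λ.n₁ Λ.k _ j :=
          ⟨⟨w - Λ.n₁, by omega⟩, Fin.ext (by rw [val_coinWire]; simp only; omega)⟩
        rw [tri_coinWire, tri_coinWire]
  · rw [Function.update_of_ne, tri_work]
    intro h
    have := congrArg Fin.val h
    rw [fin, val_finOf_of_lt _ (by omega)] at this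
    simp at this; omega

/-- The matrix of a one-gate circuit. [folklore] -/
theorem toMatrix_single {N : ℕ} (g : QGate cliffordT N) : (⟨[g]⟩ : QCircuit cliffordT N).toMatrix 0 = g.toMatrix 0 := by
  rw [QCircuit.toMatrix_cons, QCircuit.toMatrix_nil, Matrix.one_mul]

/-! ### The constants-and-coins stage -/

/-- The coins `CPreg 0`, `CPreg 1` fit in the first part. [folklore] -/
theorem CP0_add_le : Λ.CPreg 0 + 2 ≤ Λ.n₁ := by have := Λ.CPreg_lt_as (i := 1) (by norm_num); have := Λ.as_le_n₁; unfold CPreg at *; omega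

/-- **The input label of the first part**: the bits of `p` and `r` on the input wires. [folklore] -/
def xIn (d : Data) : QReg Λ.n₁ := fun q => Λ.inBit d q

/-- The first part written by the `X` gates on the input label (no coin set): `notBit`. [folklore] -/
def xK (d : Data) : QReg Λ.n₁ := fun q => Λ.notBit d q

/-- `notBit` at the coins and at `τ` is clear; `constBit` at `τ` is clear. [folklore] -/
theorem notBit_coins (d : Data) : (∀ i, i < 2 → Λ.notBit d (Λ.CPreg 0 + i) = false) ∧ Λ.notBit d Λ.tau = false ∧
    Λ.constBit d Λ.tau = false ∧ (∀ q, ¬(Λ.CPreg 0 ≤ q ∧ q < Λ.CPreg 0 + 2) → Λ.notBit d q = Λ.constBit d q) := by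
  have htcs := Λ.tau_lt_cs
  have hnot : ∀ q, ((Λ.ℓ ≤ q ∧ q < Λ.cs) ∨ (Λ.CPreg 0 ≤ q ∧ q < Λ.CPreg 0 + 2)) → Λ.notBit d q = false := by
    intro q hq
    unfold notBit
    rw [decide_eq_false (show ¬(Λ.Preg 0 ≤ q ∧ q < Λ.Preg 0 + Λ.n) by unfold Preg; unfold CPreg cs ℓ at hq; omega),
      decide_eq_false (show ¬(Λ.Rreg 0 ≤ q ∧ q < Λ.Rreg 0 + Λ.n) by unfold Rreg; unfold CPreg cs ℓ at hq; omega),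
      decide_eq_false (show ¬(Λ.T2n 0 ≤ q ∧ q < Λ.T2n 0 + (Λ.n + 1)) by unfold T2n; unfold CPreg at hq; omega),
      decide_eq_false (show ¬(Λ.Nreg 0 ≤ q ∧ q < Λ.Nreg 0 + (Λ.kap + 1)) by unfold Nreg; unfold CPreg at hq; omega),
      decide_eq_false (show ¬(Λ.BPreg 0 ≤ q ∧ q < Λ.BPreg 0 + Λ.wB) by unfold BPreg; unfold CPreg at hq; omega)]
    simp
  refine ⟨fun i hi => hnot _ (Or.inr (by omega)), hnot _ (Or.inl ⟨le_of_eq rfl, htcs⟩), Λ.constBit_of_lt_cs d htcs (le_of_eq rfl), fun q hq => ?_⟩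
  rw [Λ.constBit_eq_notBit_xor, decide_eq_false hq, Bool.false_and, Bool.xor_false]

/-- The input label vanishes beyond the input. [folklore] -/
theorem inBit_of_le (d : Data) {i : ℕ} (hi : Λ.ℓ ≤ i) : Λ.inBit d i = false := by
  unfold inBit
  rw [decide_eq_false (show ¬(Λ.Preg 0 ≤ i ∧ i < Λ.Preg 0 + Λ.n) by unfold Preg; unfold ℓ at hi; omega),
    decide_eq_false (show ¬(Λ.Rreg 0 ≤ i ∧ i < Λ.Rreg 0 + Λ.n) by unfold Rreg; unfold ℓ at hi; omega)]
  simp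

/-- **The label written by the `X` gates on the input.** [folklore] -/
theorem constX_mulVec (d : Data) :
    (⟨revCompile (toRevList Λ.constFin Λ.constFin_wf)⟩ : QCircuit cliffordT Λ.Wd).toMatrix 0 *ᵥ
        basisState (tri (Λ.xIn d) (fun _ : Fin Λ.k => false) (fun _ : Fin (Λ.kap + Λ.kap) => false)) =
      basisState (tri (Λ.xK d) (fun _ : Fin Λ.k => false) (fun _ : Fin (Λ.kap + Λ.kap) => false)) := by
  rw [revCompile_mulVec_basisState, revEval_toRevList]
  congr 1
  funext q
  show clEval (Λ.constOps.map (ClOp.map (finOf Λ.Wd Λ.Wd_pos))) _ q = _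
  rw [clEval_map_finOf_apply Λ.Wd_pos _ Λ.constOps_lt, Λ.clEval_constOps, liftW_val]
  by_cases hq : (q : ℕ) < Λ.n₁
  · rw [show q = Fin.castAdd _ ⟨q, hq⟩ from rfl, tri_castAdd, tri_castAdd]
    exact (Λ.notBit_eq_inBit_xor d q).symm
  · have has := Λ.as_le_n₁
    rw [Λ.tri_zero_zero_apply_of_le _ q (by omega), Λ.tri_zero_zero_apply_of_le _ q (by omega), Λ.notsBit_of_not (Or.inr (by omega))]
    rfl

/-- The component first part from the `X`-gate label: set the coins. [folklore] -/
theorem cx_eq_setReg (d : Data) :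
    Λ.cx d = Function.update (Λ.setReg (Λ.CPreg 0) 2 (Λ.xK d) (d.cp % 4)) ⟨Λ.tau, Λ.tau_lt_n₁⟩ d.im := by
  obtain ⟨hcoin, hτ, hcτ, hoff⟩ := Λ.notBit_coins d
  have htcs := Λ.tau_lt_cs
  funext q
  by_cases hqt : (q : ℕ) = Λ.tau
  · have : q = ⟨Λ.tau, Λ.tau_lt_n₁⟩ := Fin.ext hqt
    subst this
    rw [Function.update_self]; exact Λ.cx_tau d
  · rw [Function.update_of_ne (fun h => hqt (congrArg Fin.val h)), show Λ.cx d q = Λ.constBit d q from if_neg hqt]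
    by_cases hqc : Λ.CPreg 0 ≤ (q : ℕ) ∧ (q : ℕ) < Λ.CPreg 0 + 2
    · obtain ⟨i, hi, hqi⟩ : ∃ i, i < 2 ∧ (q : ℕ) = Λ.CPreg 0 + i := ⟨q - Λ.CPreg 0, by omega, by omega⟩
      have hqi' : (q : ℕ) = Λ.CPreg i := by rw [hqi]; unfold CPreg; omega
      rw [show Λ.setReg (Λ.CPreg 0) 2 (Λ.xK d) (d.cp % 4) q = (d.cp % 4).testBit (q - Λ.CPreg 0) by simp [setReg, hqc],
        show (q : ℕ) - Λ.CPreg 0 = i by omega, hqi', Λ.constBit_CPreg d hi, show (4 : ℕ) = 2 ^ 2 by norm_num,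
        Nat.testBit_mod_two_pow, decide_eq_true hi, Bool.true_and]
    · rw [Λ.setReg_of_not _ _ hqc]; exact (hoff _ hqc).symm

/-- **Semantics of the constants-and-coins stage**: from `|0…0⟩` to the uniform superposition of the
component labels `tri (cx ⟨p, r, c', τ⟩) 0 0` over the eight coin values. [folklore] -/
theorem constCirc_mulVec (d : Data) :
    Λ.constCirc.toMatrix 0 *ᵥ basisState (tri (Λ.xIn d) (fun _ : Fin Λ.k => false) (fun _ : Fin (Λ.kap + Λ.kap) => false)) =
      (invSqrt2 ^ 2 * invSqrt2) • ∑ cp ∈ Finset.range 4,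
        (basisState (tri (Λ.cx ⟨d.p, d.r, cp, false⟩) (fun _ : Fin Λ.k => false) (fun _ : Fin (Λ.kap + Λ.kap) => false)) +
         basisState (tri (Λ.cx ⟨d.p, d.r, cp, true⟩) (fun _ : Fin Λ.k => false) (fun _ : Fin (Λ.kap + Λ.kap) => false))) := by
  obtain ⟨hcoin, hτ, -, -⟩ := Λ.notBit_coins d
  have hsplit : (⟨[hOn (Λ.fin (Λ.CPreg 0 + 0)), hOn (Λ.fin (Λ.CPreg 0 + 1)), hOn (Λ.fin Λ.tau)]⟩ : QCircuit cliffordT Λ.Wd) =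
      (⟨(Λ.regWires (Λ.CPreg 0) 2).map hOn⟩ : QCircuit cliffordT Λ.Wd).append ⟨[hOn (Λ.fin Λ.tau)]⟩ := by
    simp [regWires, QCircuit.append, List.range_succ]
  rw [constCirc, QCircuit.toMatrix_append, ← Matrix.mulVec_mulVec, Λ.constX_mulVec, hsplit, QCircuit.toMatrix_append,
    ← Matrix.mulVec_mulVec, Λ.hadamards_reg_mulVec Λ.CP0_add_le _ (fun i hi => hcoin i hi), Matrix.mulVec_smul, Matrix.mulVec_sum,
    toMatrix_single, mul_smul]
  congr 1
  rw [show (2 : ℕ) ^ 2 = 4 by norm_num, Finset.smul_sum]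
  refine Finset.sum_congr rfl fun cp hcp => ?_
  have hτ0 : tri (Λ.setReg (Λ.CPreg 0) 2 (Λ.xK d) cp) (fun _ : Fin Λ.k => false) (fun _ : Fin (Λ.kap + Λ.kap) => false) (Λ.fin Λ.tau) =
      false := by
    rw [Λ.tri_fin_of_lt _ _ _ Λ.tau_lt_n₁, Λ.setReg_of_not _ _ (by simp only; unfold CPreg; have := Λ.tau_lt_cs; omega)]; exact hτ
  rw [hOn_mulVec_basisState _ _ hτ0, Λ.update_tri_fin _ _ _ Λ.tau_lt_n₁]
  have hcp4 : cp % 4 = cp := Nat.mod_eq_of_lt (Finset.mem_range.1 hcp)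
  have e0 : Λ.cx ⟨d.p, d.r, cp, false⟩ = Λ.setReg (Λ.CPreg 0) 2 (Λ.xK d) cp := by
    rw [Λ.cx_eq_setReg]; simp only [hcp4]
    exact Function.update_eq_self_iff.2 (by rw [Λ.setReg_of_not _ _ (by simp only; unfold CPreg; have := Λ.tau_lt_cs; omega)]; exact hτ.symm)
  have e1 : Λ.cx ⟨d.p, d.r, cp, true⟩ = Function.update (Λ.setReg (Λ.CPreg 0) 2 (Λ.xK d) cp) ⟨Λ.tau, Λ.tau_lt_n₁⟩ true := by
    rw [Λ.cx_eq_setReg]; simp only [hcp4]; rfl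
  rw [e0, e1]

/-! ### The preparation stage -/

/-- The data fit the layout. [folklore] -/
structure DataOK (d : Data) : Prop where
  /-- `p < 2ⁿ` -/
  p_lt : d.p < 2 ^ Λ.n
  /-- `r < 2ⁿ` -/
  r_lt : d.r < 2 ^ Λ.n
  /-- `c' < 4` -/
  cp_lt : d.cp < 4

/-- Positions inside the first part. [folklore] -/
theorem c_lt_n₁ : Λ.c < Λ.n₁ := lt_of_lt_of_le Λ.c_lt_as Λ.as_le_n₁
/-- Positions inside the first part. [folklore] -/
theorem f_lt_n₁ : Λ.f < Λ.n₁ := lt_of_lt_of_le Λ.f_lt_as Λ.as_le_n₁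
/-- The register `X` fits in the first part. [folklore] -/
theorem X0_add_le : Λ.X 0 + Λ.n ≤ Λ.n₁ := by have := Λ.f_lt_n₁; unfold X; unfold f at this; omega
/-- The register `J` fits in the first part. [folklore] -/
theorem J0_add_le : Λ.J 0 + Λ.lam ≤ Λ.n₁ := by
  have := Λ.as_le_n₁; unfold J; unfold as cs at this; omega

/-- The total extension of a first part. [folklore] -/
def xv (x : QReg Λ.n₁) (q : ℕ) : Bool := if h : q < Λ.n₁ then x ⟨q, h⟩ else false

/-- `xv` below `n₁`. [folklore] -/
theorem xv_of_lt (x : QReg Λ.n₁) {q : ℕ} (hq : q < Λ.n₁) : Λ.xv x q = x ⟨q, hq⟩ := by simp [xv, hq]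

/-- Set the control bit. [folklore] -/
def xc (x : QReg Λ.n₁) (b : Bool) : QReg Λ.n₁ := Function.update x ⟨Λ.c, Λ.c_lt_n₁⟩ b
/-- Set the value register `X`. [folklore] -/
def xX (x : QReg Λ.n₁) (s : ℕ) : QReg Λ.n₁ := Λ.setReg (Λ.X 0) Λ.n x s
/-- Set the flag. [folklore] -/
def xf (x : QReg Λ.n₁) (b : Bool) : QReg Λ.n₁ := Function.update x ⟨Λ.f, Λ.f_lt_n₁⟩ b

/-- The registers read by the flag block off a three-part label. [folklore] -/
theorem regs_fs₁ (x : QReg Λ.n₁) (y : QReg Λ.k) (ρ : QReg (Λ.kap + Λ.kap)) :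
    PXor.regs Λ.Wd_pos Λ.fs₁ (tri x y ρ) =
      [[Λ.xv x Λ.c], (List.range Λ.n).map fun i => Λ.xv x (Λ.X i), (List.range Λ.n).map fun i => Λ.xv x (Λ.Preg i),
        (List.range Λ.n).map fun i => Λ.xv x (Λ.Rreg i), (List.range 2).map fun i => Λ.xv x (Λ.CPreg i)] := by
  have has := Λ.as_le_n₁
  simp only [PXor.regs, fs₁, regs, ps₁, List.map_cons, List.map_nil, reg, List.map_map, List.cons.injEq, and_true,
    List.range_one]
  refine ⟨?_, ?_, ?_, ?_, ?_⟩
  · rw [show finOf Λ.Wd Λ.Wd_pos Λ.c = Λ.fin Λ.c from rfl, Λ.tri_fin_of_lt _ _ _ Λ.c_lt_n₁, Λ.xv_of_lt _ Λ.c_lt_n₁]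
  all_goals refine List.map_congr_left fun i hi => ?_
  all_goals rw [List.mem_range] at hi
  · rw [Function.comp_apply, show finOf Λ.Wd Λ.Wd_pos (Λ.X i) = Λ.fin (Λ.X i) from rfl,
      Λ.tri_fin_of_lt _ _ _ (by have := Λ.X_lt_as hi; omega), Λ.xv_of_lt]
  · rw [Function.comp_apply, show finOf Λ.Wd Λ.Wd_pos (Λ.Preg i) = Λ.fin (Λ.Preg i) from rfl,
      Λ.tri_fin_of_lt _ _ _ (by have := Λ.Preg_lt_as hi; omega), Λ.xv_of_lt]
  · rw [Function.comp_apply, show finOf Λ.Wd Λ.Wd_pos (Λ.Rreg i) = Λ.fin (Λ.Rreg i) from rfl,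
      Λ.tri_fin_of_lt _ _ _ (by have := Λ.Rreg_lt_as hi; omega), Λ.xv_of_lt]
  · rw [Function.comp_apply, show finOf Λ.Wd Λ.Wd_pos (Λ.CPreg i) = Λ.fin (Λ.CPreg i) from rfl,
      Λ.tri_fin_of_lt _ _ _ (by have := Λ.CPreg_lt_as hi; omega), Λ.xv_of_lt]

/-- The control, the value register, the flag and the repetition register precede the constants. [folklore] -/
theorem lt_cs_facts : Λ.c < Λ.cs ∧ (∀ i, i < Λ.n → Λ.X i < Λ.cs) ∧ Λ.f < Λ.cs ∧ (∀ i, i < Λ.lam → Λ.J i < Λ.cs) ∧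
    Λ.X 0 + Λ.n = Λ.f ∧ Λ.cs ≤ Λ.as := by
  refine ⟨by unfold c cs; omega, fun i hi => by unfold X cs; omega, by unfold f cs; omega, fun i hi => by unfold J cs; omega,
    by unfold X f; omega, by unfold as; omega⟩

/-- **The output of the flag machine** on a label whose control bit is `cb`, whose value register holds
`s < 2ⁿ` and whose constant registers hold `p, r, c'`. [cite: VanDamSeroussi2002, §4 Thm. 1 (proof, step 1)] -/
theorem flag_fn {d : Data} (hd : Λ.DataOK d) (x : QReg Λ.n₁) {cb : Bool} {s : ℕ} (hs : s < 2 ^ Λ.n)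
    (hc : Λ.xv x Λ.c = cb) (hX : ∀ i, i < Λ.n → Λ.xv x (Λ.X i) = s.testBit i)
    (hP : ∀ i, i < Λ.n → Λ.xv x (Λ.Preg i) = d.p.testBit i) (hR : ∀ i, i < Λ.n → Λ.xv x (Λ.Rreg i) = d.r.testBit i)
    (hCP : ∀ i, i < 2 → Λ.xv x (Λ.CPreg i) = d.cp.testBit i) (y : QReg Λ.k) (ρ : QReg (Λ.kap + Λ.kap)) :
    mach₁.fn (PXor.pairStr (PXor.regs Λ.Wd_pos Λ.fs₁ (tri x y ρ))) = bitE (flagVal cb.toNat s d.p d.r d.cp) := by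
  have hregs : PXor.regs Λ.Wd_pos Λ.fs₁ (tri x y ρ) =
      [[cb], Layout.bitsLE s Λ.n, Layout.bitsLE d.p Λ.n, Layout.bitsLE d.r Λ.n, Layout.bitsLE d.cp 2] := by
    rw [Λ.regs_fs₁, hc]
    simp only [Layout.bitsLE, List.cons.injEq, and_true, true_and]
    exact ⟨List.map_congr_left fun i hi => hX i (List.mem_range.1 hi), List.map_congr_left fun i hi => hP i (List.mem_range.1 hi),
      List.map_congr_left fun i hi => hR i (List.mem_range.1 hi), List.map_congr_left fun i hi => hCP i (List.mem_range.1 hi)⟩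
  rw [hregs, show PXor.pairStr [[cb], Layout.bitsLE s Λ.n, Layout.bitsLE d.p Λ.n, Layout.bitsLE d.r Λ.n, Layout.bitsLE d.cp 2] =
    flagE ([cb], (Layout.bitsLE s Λ.n, (Layout.bitsLE d.p Λ.n, (Layout.bitsLE d.r Λ.n, Layout.bitsLE d.cp 2)))) from rfl,
    mach₁, Mach.ofCodeFP_fn]
  simp only [bitsToNat_bitsLE, Nat.mod_eq_of_lt hs, Nat.mod_eq_of_lt hd.p_lt, Nat.mod_eq_of_lt hd.r_lt,
    Nat.mod_eq_of_lt (show d.cp < 2 ^ 2 by have := hd.cp_lt; norm_num; omega)]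
  cases cb <;> simp [bitsToNat]

/-- **The flag block on such a label**: the flag is XORed with `flagVal`, nothing else moves.
[cite: VanDamSeroussi2002, §4 Thm. 1 (proof, step 1)] -/
theorem clEval_ops₁ {d : Data} (hd : Λ.DataOK d) (x : QReg Λ.n₁) (harea : ∀ q (hq : q < Λ.n₁), Λ.as ≤ q → x ⟨q, hq⟩ = false)
    {cb : Bool} {s : ℕ} (hs : s < 2 ^ Λ.n) (hc : Λ.xv x Λ.c = cb) (hX : ∀ i, i < Λ.n → Λ.xv x (Λ.X i) = s.testBit i)
    (hP : ∀ i, i < Λ.n → Λ.xv x (Λ.Preg i) = d.p.testBit i) (hR : ∀ i, i < Λ.n → Λ.xv x (Λ.Rreg i) = d.r.testBit i)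
    (hCP : ∀ i, i < 2 → Λ.xv x (Λ.CPreg i) = d.cp.testBit i) (hf : x ⟨Λ.f, Λ.f_lt_n₁⟩ = false)
    (y : QReg Λ.k) (ρ : QReg (Λ.kap + Λ.kap)) :
    clEval (PXor.ops Λ.Wd_pos mach₁.e mach₁.M Λ.as Λ.fs₁ 1 fun _ => Λ.f) (tri x y ρ) =
      tri (Λ.xf x (flagVal cb.toNat s d.p d.r d.cp)) y ρ := by
  have hM := mach₁.spec (PXor.pairStr (PXor.regs Λ.Wd_pos Λ.fs₁ (tri x y ρ)))
  rw [Λ.flag_fn hd x hs hc hX hP hR hCP] at hM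
  have htop : PXor.top mach₁.e mach₁.M Λ.as Λ.fs₁ ≤ Λ.n₁ := by rw [Λ.top_eq Λ.length_slots_fs.1]; exact Λ.tops_le.1
  have hclean : ∀ q, Λ.as ≤ q → q < PXor.top mach₁.e mach₁.M Λ.as Λ.fs₁ → tri x y ρ (finOf Λ.Wd Λ.Wd_pos q) = false := by
    intro q h1 h2
    rw [show finOf Λ.Wd Λ.Wd_pos q = Λ.fin q from rfl, Λ.tri_fin_of_lt _ _ _ (by omega)]
    exact harea q (by omega) h1
  have htgt : CleanXor.tgt Λ.Wd_pos (fun _ => Λ.f) 0 = Λ.fin Λ.f := rfl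
  rw [xf, ← Λ.update_tri_fin x y ρ Λ.f_lt_n₁]
  funext q
  by_cases hq : q = Λ.fin Λ.f
  · subst hq
    rw [Function.update_self, ← htgt, PXor.clEval_ops_target Λ.geom₁ _ hclean _ hM (show 0 < 1 from Nat.one_pos), htgt,
      Λ.tri_fin_of_lt _ _ _ Λ.f_lt_n₁, hf, Bool.false_xor, decide_getElem?_eq]
    simp [bitE]
  · rw [Function.update_of_ne hq, PXor.clEval_ops_of_ne Λ.geom₁ _ q fun j hj => by
      have : j = 0 := by omega
      subst this; rwa [htgt]]

/-- **The state after the preparation stage**: an equal superposition of the idle branch `c = 0` and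
of the branch `c = 1` carrying the uniform superposition over the values `s < 2ⁿ`, each flagged by
`flagVal 1 s p r c'` (`= [s ∉ C_{c'}]`). [cite: VanDamSeroussi2002, §4 Thm. 1 (proof, step 1: (|0⟩|∅⟩ + |1⟩|χ⟩)/√2)] -/
theorem prepCirc_mulVec {d : Data} (hd : Λ.DataOK d) :
    Λ.prepCirc.toMatrix 0 *ᵥ basisState (tri (Λ.cx d) (fun _ => false) (fun _ => false)) =
      invSqrt2 • basisState (tri (Λ.cx d) (fun _ => false) (fun _ => false)) +
        (invSqrt2 * invSqrt2 ^ Λ.n) • ∑ s ∈ Finset.range (2 ^ Λ.n),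
          basisState (tri (Λ.xf (Λ.xX (Λ.xc (Λ.cx d) true) s) (flagVal 1 s d.p d.r d.cp)) (fun _ => false) (fun _ => false)) := by
  obtain ⟨hccs, hXcs, hfcs, -, hXf, hcsas⟩ := Λ.lt_cs_facts
  set x₀ := Λ.cx d with hx₀
  set z₀ : QReg Λ.Wd := tri x₀ (fun _ => false) (fun _ => false) with hz₀
  have htc := Λ.tau_lt_c
  have hx₀v : ∀ q (hq : q < Λ.n₁), Λ.tau < q → q < Λ.cs → x₀ ⟨q, hq⟩ = false := fun q hq ht hlt => Λ.cx_of_lt_cs d hlt ht hq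
  have harea : ∀ q (hq : q < Λ.n₁), Λ.as ≤ q → x₀ ⟨q, hq⟩ = false := fun q hq hle => Λ.cx_of_as_le d hle hq
  -- the Hadamard gate on the control
  have hc0 : z₀ (Λ.fin Λ.c) = false := by rw [hz₀, Λ.tri_fin_of_lt _ _ _ Λ.c_lt_n₁]; exact hx₀v _ _ htc hccs
  set z₁ : QReg Λ.Wd := tri (Λ.xc x₀ true) (fun _ => false) (fun _ => false) with hz₁
  have hz₁eq : Function.update z₀ (Λ.fin Λ.c) true = z₁ := by rw [hz₀, Λ.update_tri_fin _ _ _ Λ.c_lt_n₁]; rfl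
  have hH : (⟨[hOn (Λ.fin Λ.c)]⟩ : QCircuit cliffordT Λ.Wd).toMatrix 0 *ᵥ basisState z₀ =
      invSqrt2 • (basisState z₀ + basisState z₁) := by
    rw [toMatrix_single, hOn_mulVec_basisState _ _ hc0, hz₁eq]
  -- the controlled Hadamard layer
  have hc1 : z₁ (Λ.fin Λ.c) = true := by
    rw [hz₁, Λ.tri_fin_of_lt _ _ _ Λ.c_lt_n₁, xc, Function.update_self]
  have hCH₀ : (⟨chLayer (Λ.fin Λ.c) Λ.Xs Λ.c_ne_Xs⟩ : QCircuit cliffordT Λ.Wd).toMatrix 0 *ᵥ basisState z₀ = basisState z₀ :=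
    chLayer_mulVec_of_not_control 0 _ _ _ fun z hz => by
      rw [basisState_apply]; split_ifs with h
      · subst h; rw [hc0] at hz; exact absurd hz (by decide)
      · rfl
  have hXclean : ∀ i (hi : i < Λ.n), Λ.xc x₀ true ⟨Λ.X 0 + i, by have := Λ.X0_add_le; omega⟩ = false := by
    intro i hi
    rw [xc, Function.update_of_ne (fun h => by have := congrArg Fin.val h; simp only [c, X] at this; omega)]
    exact hx₀v _ _ (by unfold X tau; omega) (by have := hXcs i hi; unfold X at this ⊢; omega)
  have hCH₁ : (⟨chLayer (Λ.fin Λ.c) Λ.Xs Λ.c_ne_Xs⟩ : QCircuit cliffordT Λ.Wd).toMatrix 0 *ᵥ basisState z₁ =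
      invSqrt2 ^ Λ.n • ∑ s ∈ Finset.range (2 ^ Λ.n), basisState (tri (Λ.xX (Λ.xc x₀ true) s) (fun _ => false) (fun _ => false)) := by
    rw [chLayer_mulVec_of_control 0 _ _ _ fun z hz => by
      rw [basisState_apply]; split_ifs with h
      · subst h; rw [hc1] at hz; exact absurd hz (by decide)
      · rfl]
    exact Λ.hadamards_reg_mulVec Λ.X0_add_le _ hXclean _ _
  -- the flag block
  have hP : ∀ i, i < Λ.n → Λ.xv x₀ (Λ.Preg i) = d.p.testBit i := fun i hi => by
    rw [Λ.xv_of_lt _ (lt_of_lt_of_le (Λ.Preg_lt_as hi) Λ.as_le_n₁)]; exact Λ.cx_Preg d hi _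
  have hR : ∀ i, i < Λ.n → Λ.xv x₀ (Λ.Rreg i) = d.r.testBit i := fun i hi => by
    rw [Λ.xv_of_lt _ (lt_of_lt_of_le (Λ.Rreg_lt_as hi) Λ.as_le_n₁)]; exact Λ.cx_Rreg d hi _
  have hCP : ∀ i, i < 2 → Λ.xv x₀ (Λ.CPreg i) = d.cp.testBit i := fun i hi => by
    rw [Λ.xv_of_lt _ (lt_of_lt_of_le (Λ.CPreg_lt_as hi) Λ.as_le_n₁)]; exact Λ.cx_CPreg d hi _
  have htX : ∀ i, Λ.tau < Λ.X i := fun i => by unfold X tau; omega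
  have htf : Λ.tau < Λ.f := by unfold f tau; omega
  have hF₀ : clEval (PXor.ops Λ.Wd_pos mach₁.e mach₁.M Λ.as Λ.fs₁ 1 fun _ => Λ.f) z₀ = z₀ := by
    rw [hz₀, Λ.clEval_ops₁ hd x₀ harea (s := 0) (cb := false) (by positivity) (by rw [Λ.xv_of_lt _ Λ.c_lt_n₁]; exact hx₀v _ _ htc hccs)
      (fun i hi => by
        rw [Λ.xv_of_lt _ (by have := Λ.X_lt_as hi; have := Λ.as_le_n₁; omega), Nat.zero_testBit]; exact hx₀v _ _ (htX i) (hXcs i hi))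
      hP hR hCP (hx₀v _ _ htf hfcs)]
    have hflag : flagVal false.toNat 0 d.p d.r d.cp = false := by simp [flagVal]
    rw [hflag, xf]
    congr 1
    exact Function.update_eq_self_iff.2 (hx₀v _ _ htf hfcs).symm
  have hF₁ : ∀ s, s < 2 ^ Λ.n → clEval (PXor.ops Λ.Wd_pos mach₁.e mach₁.M Λ.as Λ.fs₁ 1 fun _ => Λ.f)
      (tri (Λ.xX (Λ.xc x₀ true) s) (fun _ => false) (fun _ => false)) =
      tri (Λ.xf (Λ.xX (Λ.xc x₀ true) s) (flagVal 1 s d.p d.r d.cp)) (fun _ => false) (fun _ => false) := by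
    intro s hs
    have hXas := Λ.X0_add_le
    have hxX : ∀ q (hq : q < Λ.n₁), ¬(Λ.X 0 ≤ q ∧ q < Λ.X 0 + Λ.n) → q ≠ Λ.c → Λ.xX (Λ.xc x₀ true) s ⟨q, hq⟩ = x₀ ⟨q, hq⟩ := by
      intro q hq h1 h2
      rw [xX, Λ.setReg_of_not _ _ (by simpa using h1), xc, Function.update_of_ne (fun h => h2 (congrArg Fin.val h))]
    have hcX : Λ.c < Λ.X 0 := by unfold c X; omega
    have := Λ.clEval_ops₁ hd (Λ.xX (Λ.xc x₀ true) s) (fun q hq hle => by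
        rw [hxX q hq (by unfold as at hle; omega) (by omega)]; exact harea q hq hle)
      (cb := true) hs
      (by rw [Λ.xv_of_lt _ Λ.c_lt_n₁, xX, Λ.setReg_of_not _ _ (by simp only; omega), xc, Function.update_self])
      (fun i hi => by
        have hXi : Λ.X i = Λ.X 0 + i := by unfold X; omega
        rw [Λ.xv_of_lt _ (by omega), show (⟨Λ.X i, (by omega : Λ.X i < Λ.n₁)⟩ : Fin Λ.n₁) = ⟨Λ.X 0 + i, by omega⟩ from Fin.ext hXi,
          xX, Λ.setReg_of_mem _ _ hi])
      (fun i hi => by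
        have h1 := Λ.Preg_lt_as hi; have h2 := Λ.as_le_n₁
        rw [Λ.xv_of_lt _ (by omega), hxX _ _ (by unfold Preg X ℓ; omega) (by unfold Preg c ℓ; omega)]; exact Λ.cx_Preg d hi _)
      (fun i hi => by
        have h1 := Λ.Rreg_lt_as hi; have h2 := Λ.as_le_n₁
        rw [Λ.xv_of_lt _ (by omega), hxX _ _ (by unfold Rreg X ℓ; omega) (by unfold Rreg c ℓ; omega)]; exact Λ.cx_Rreg d hi _)
      (fun i hi => by
        have h1 := Λ.CPreg_lt_as hi; have h2 := Λ.as_le_n₁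
        rw [Λ.xv_of_lt _ (by omega), hxX _ _ (by unfold CPreg; omega) (by unfold CPreg; omega)]; exact Λ.cx_CPreg d hi _)
      (by rw [hxX _ _ (by omega) (by omega)]; exact hx₀v _ _ htf hfcs) (fun _ => false) (fun _ => false)
    simpa using this
  -- assemble
  rw [prepCirc, QCircuit.toMatrix_append, QCircuit.toMatrix_append, ← Matrix.mulVec_mulVec, ← Matrix.mulVec_mulVec, hH,
    Matrix.mulVec_smul, Matrix.mulVec_add, hCH₀, hCH₁, Matrix.mulVec_smul, Matrix.mulVec_add,
    (PXor.isBasisMap_circuit Λ.geom₁) z₀, hF₀, Matrix.mulVec_smul, Matrix.mulVec_sum, smul_add, smul_smul]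
  congr 2
  refine Finset.sum_congr rfl fun s hs => ?_
  rw [(PXor.isBasisMap_circuit Λ.geom₁) _, hF₁ s (Finset.mem_range.1 hs)]

/-! ### The repetition stage -/

/-- The classical part of the repetition stage on the label with repetition index `j`:
`Y ^= x + jp`, then `X ++ J ^= split Y`. [folklore] -/
def rmap (x : QReg Λ.n₁) (jv : ℕ) : QReg Λ.Wd :=
  clEval (PXor.ops Λ.Wd_pos mach₃.e mach₃.M Λ.as Λ.fs₃ (Λ.n + Λ.lam) Λ.tXJ)
    (clEval (PXor.ops Λ.Wd_pos mach₂.e mach₂.M Λ.as Λ.fs₂ Λ.kap Λ.Y)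
      (tri (Λ.setReg (Λ.J 0) Λ.lam x jv) (fun _ => false) (fun _ => false)))

/-- **The repetition stage**, as far as linearity goes: Hadamard gates on the clean register `J`, then
two basis maps. [cite: VanDamSeroussi2002, §4 Thm. 1 (proof)] -/
theorem repCirc_mulVec (x : QReg Λ.n₁) (hJ : ∀ i (hi : i < Λ.lam), x ⟨Λ.J 0 + i, by have := Λ.J0_add_le; omega⟩ = false) :
    Λ.repCirc.toMatrix 0 *ᵥ basisState (tri x (fun _ => false) (fun _ => false)) =
      invSqrt2 ^ Λ.lam • ∑ jv ∈ Finset.range (2 ^ Λ.lam), basisState (Λ.rmap x jv) := by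
  rw [repCirc, QCircuit.toMatrix_append, QCircuit.toMatrix_append, ← Matrix.mulVec_mulVec, ← Matrix.mulVec_mulVec,
    show (⟨(List.range Λ.lam).map fun i => hOn (Λ.fin (Λ.J 0 + i))⟩ : QCircuit cliffordT Λ.Wd) =
      ⟨(Λ.regWires (Λ.J 0) Λ.lam).map hOn⟩ by simp [regWires, List.map_map],
    Λ.hadamards_reg_mulVec Λ.J0_add_le x hJ, Matrix.mulVec_smul, Matrix.mulVec_sum, Matrix.mulVec_smul, Matrix.mulVec_sum]
  congr 1
  refine Finset.sum_congr rfl fun jv _ => ?_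
  rw [(PXor.isBasisMap_circuit Λ.geom₂) _, (PXor.isBasisMap_circuit Λ.geom₃) _]; rfl

/-- The repetition stage does not touch the flag. [folklore] -/
theorem rmap_fin_f (x : QReg Λ.n₁) (jv : ℕ) : Λ.rmap x jv (Λ.fin Λ.f) = x ⟨Λ.f, Λ.f_lt_n₁⟩ := by
  obtain ⟨-, -, hfcs, -, hXf, hcsas⟩ := Λ.lt_cs_facts
  have has := Λ.as_le_n₁; have hW := Λ.n₁_le_Wd
  unfold rmap
  rw [PXor.clEval_ops_of_ne Λ.geom₃ _ _ fun j hj h => ?_, PXor.clEval_ops_of_ne Λ.geom₂ _ _ fun j hj h => ?_,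
    Λ.tri_fin_of_lt _ _ _ Λ.f_lt_n₁, Λ.setReg_of_not _ _ (by simp only; unfold J f; omega)]
  · have := congrArg Fin.val h
    rw [CleanXor.tgt, fin, val_finOf_of_lt _ (by omega), val_finOf_of_lt _ (Λ.Y_lt_Wd hj)] at this
    have := Λ.n₁_le_Y j; omega
  · have := congrArg Fin.val h
    have htlt : Λ.tXJ j < Λ.n₁ := by unfold tXJ; split_ifs with h' <;> [have := Λ.X_lt_as h'; have := Λ.J_lt_as (i := j - Λ.n) (by omega)] <;> omega
    rw [CleanXor.tgt, fin, val_finOf_of_lt _ (by omega), val_finOf_of_lt _ (by omega)] at this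
    revert this; unfold tXJ; split_ifs <;> simp only [X, J, f] <;> omega

/-- The registers read by the repetition block off a three-part label. [folklore] -/
theorem regs_fs₂ (x : QReg Λ.n₁) (y : QReg Λ.k) (ρ : QReg (Λ.kap + Λ.kap)) :
    PXor.regs Λ.Wd_pos Λ.fs₂ (tri x y ρ) =
      [(List.range Λ.n).map fun i => Λ.xv x (Λ.X i), (List.range Λ.lam).map fun i => Λ.xv x (Λ.J i),
        (List.range Λ.n).map fun i => Λ.xv x (Λ.Preg i)] := by
  have has := Λ.as_le_n₁
  simp only [PXor.regs, fs₂, regs, ps₂, List.map_cons, List.map_nil, reg, List.map_map, List.cons.injEq, and_true]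
  refine ⟨?_, ?_, ?_⟩
  all_goals refine List.map_congr_left fun i hi => ?_
  all_goals rw [List.mem_range] at hi
  · rw [Function.comp_apply, show finOf Λ.Wd Λ.Wd_pos (Λ.X i) = Λ.fin (Λ.X i) from rfl,
      Λ.tri_fin_of_lt _ _ _ (by have := Λ.X_lt_as hi; omega), Λ.xv_of_lt]
  · rw [Function.comp_apply, show finOf Λ.Wd Λ.Wd_pos (Λ.J i) = Λ.fin (Λ.J i) from rfl,
      Λ.tri_fin_of_lt _ _ _ (by have := Λ.J_lt_as hi; omega), Λ.xv_of_lt]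
  · rw [Function.comp_apply, show finOf Λ.Wd Λ.Wd_pos (Λ.Preg i) = Λ.fin (Λ.Preg i) from rfl,
      Λ.tri_fin_of_lt _ _ _ (by have := Λ.Preg_lt_as hi; omega), Λ.xv_of_lt]

/-- The registers read by the splitting block off a three-part label. [folklore] -/
theorem regs_fs₃ (x : QReg Λ.n₁) (y : QReg Λ.k) (yv pv : ℕ) :
    PXor.regs Λ.Wd_pos Λ.fs₃ (tri x y (Λ.yp yv pv)) =
      [Layout.bitsLE yv Λ.kap, (List.range Λ.n).map fun i => Λ.xv x (Λ.Preg i), (List.range (Λ.n + 1)).map fun i => Λ.xv x (Λ.T2n i)] := by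
  have has := Λ.as_le_n₁
  simp only [PXor.regs, fs₃, regs, ps₃, List.map_cons, List.map_nil, reg, List.map_map, List.cons.injEq, and_true]
  refine ⟨?_, ?_, ?_⟩
  all_goals refine List.map_congr_left fun i hi => ?_
  all_goals rw [List.mem_range] at hi
  · rw [Function.comp_apply, show finOf Λ.Wd Λ.Wd_pos (Λ.Y i) = Λ.fin (Λ.Y i) from rfl, Λ.tri_fin_Y _ _ _ hi, yp]
    simp [hi]
  · rw [Function.comp_apply, show finOf Λ.Wd Λ.Wd_pos (Λ.Preg i) = Λ.fin (Λ.Preg i) from rfl,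
      Λ.tri_fin_of_lt _ _ _ (by have := Λ.Preg_lt_as hi; omega), Λ.xv_of_lt]
  · rw [Function.comp_apply, show finOf Λ.Wd Λ.Wd_pos (Λ.T2n i) = Λ.fin (Λ.T2n i) from rfl,
      Λ.tri_fin_of_lt _ _ _ (by have := Λ.T2n_lt_as hi; omega), Λ.xv_of_lt]

/-- `yp 0 0` is the clean work part. [folklore] -/
theorem yp_zero_zero : Λ.yp 0 0 = fun _ => false := by
  funext l; simp [yp]

/-- Two three-part labels with the same tests and work parts agree beyond the first part. [folklore] -/
theorem tri_apply_eq_of_le (x x' : QReg Λ.n₁) (y : QReg Λ.k) (ρ : QReg (Λ.kap + Λ.kap)) (q : Fin Λ.Wd) (hq : Λ.n₁ ≤ (q : ℕ)) :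
    tri x y ρ q = tri x' y ρ q := by
  induction q using Fin.addCases with
  | left i => exact absurd hq (by simp)
  | right i =>
    induction i using Fin.addCases with
    | left j =>
      rw [show Fin.natAdd Λ.n₁ (Fin.castAdd (Λ.kap + Λ.kap) j) = coinWire Λ.n₁ Λ.k _ j from rfl, tri_coinWire, tri_coinWire]
    | right l => rw [tri_work, tri_work]

/-- Bits of `s + 2ⁿ·j` for `s < 2ⁿ`. [folklore] -/
theorem testBit_add_two_pow_mul {n s : ℕ} (hs : s < 2 ^ n) (jv i : ℕ) :
    (s + 2 ^ n * jv).testBit i = if i < n then s.testBit i else jv.testBit (i - n) := by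
  rw [add_comm, Nat.testBit_two_pow_mul_add _ hs]

/-- **The repetition stage on a good label**: with `X = s < p`, `J` clean and the constants in
place, the label with repetition index `j` ends with `X` and `J` clean and `Y = s + jp`.
[cite: VanDamSeroussi2002, §4 Thm. 1 (proof)] -/
theorem rmap_good {d : Data} (hd : Λ.DataOK d) (x : QReg Λ.n₁) (harea : ∀ q (hq : q < Λ.n₁), Λ.as ≤ q → x ⟨q, hq⟩ = false)
    {s : ℕ} (hsp : s < d.p) (hX : ∀ i, i < Λ.n → Λ.xv x (Λ.X i) = s.testBit i)
    (hJ : ∀ i, i < Λ.lam → Λ.xv x (Λ.J i) = false) (hP : ∀ i, i < Λ.n → Λ.xv x (Λ.Preg i) = d.p.testBit i)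
    (hT : ∀ i, i < Λ.n + 1 → Λ.xv x (Λ.T2n i) = (2 ^ Λ.n).testBit i) {jv : ℕ} (hjv : jv < 2 ^ Λ.lam) :
    Λ.rmap x jv = tri (Λ.setReg (Λ.X 0) Λ.n x 0) (fun _ => false) (Λ.yp (s + jv * d.p) 0) := by
  obtain ⟨hccs, hXcs, hfcs, hJcs, hXf, hcsas⟩ := Λ.lt_cs_facts
  have has := Λ.as_le_n₁; have hW := Λ.n₁_le_Wd; have hXle := Λ.X0_add_le; have hJle := Λ.J0_add_le
  have hfJ : Λ.f < Λ.J 0 := by unfold f J; omega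
  have hJcs' : Λ.J 0 + Λ.lam ≤ Λ.cs := by unfold J cs; omega
  have hs : s < 2 ^ Λ.n := hsp.trans hd.p_lt
  have hpn : d.p % 2 ^ Λ.n = d.p := Nat.mod_eq_of_lt hd.p_lt
  have h2n : 2 ^ Λ.n % 2 ^ (Λ.n + 1) = 2 ^ Λ.n := Nat.mod_eq_of_lt (Nat.pow_lt_pow_succ (by norm_num))
  set yv := s + jv * d.p with hyv
  have hyvlt : yv < 2 ^ Λ.kap := by
    have h1 : jv * d.p < 2 ^ Λ.lam * 2 ^ Λ.n := Nat.mul_lt_mul_of_lt_of_le hjv hd.p_lt.le (by positivity)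
    have h2 : 2 ^ Λ.lam * 2 ^ Λ.n = 2 ^ (Λ.lam + Λ.n) := (pow_add 2 _ _).symm
    have h3 : 2 ^ Λ.n ≤ 2 ^ (Λ.lam + Λ.n) := Nat.pow_le_pow_right (by norm_num) (by omega)
    have h4 : 2 ^ (Λ.lam + Λ.n) + 2 ^ (Λ.lam + Λ.n) ≤ 2 ^ Λ.kap := by
      rw [← two_mul, ← pow_succ']; exact Nat.pow_le_pow_right (by norm_num) (by unfold kap; omega)
    omega
  have hyvm : yv % 2 ^ Λ.kap = yv := Nat.mod_eq_of_lt hyvlt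
  set x' := Λ.setReg (Λ.J 0) Λ.lam x jv with hx'
  -- the first part with `J = jv`
  have hx'off : ∀ q (hq : q < Λ.n₁), ¬(Λ.J 0 ≤ q ∧ q < Λ.J 0 + Λ.lam) → x' ⟨q, hq⟩ = x ⟨q, hq⟩ := fun q hq h =>
    Λ.setReg_of_not _ _ (by simpa using h)
  have hx'X : ∀ i, i < Λ.n → Λ.xv x' (Λ.X i) = s.testBit i := fun i hi => by
    have h1 := hXcs i hi
    rw [Λ.xv_of_lt _ (by omega), hx'off _ _ (by unfold X at h1 ⊢; unfold f at hfJ; omega), ← Λ.xv_of_lt x (by omega)]; exact hX i hi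
  have hx'J : ∀ i, i < Λ.lam → Λ.xv x' (Λ.J i) = jv.testBit i := fun i hi => by
    have hJi : Λ.J i = Λ.J 0 + i := by unfold J; omega
    rw [Λ.xv_of_lt _ (by omega), show (⟨Λ.J i, (by omega : Λ.J i < Λ.n₁)⟩ : Fin Λ.n₁) = ⟨Λ.J 0 + i, by omega⟩ from Fin.ext hJi,
      hx', Λ.setReg_of_mem _ _ hi]
  have hx'P : ∀ i, i < Λ.n → Λ.xv x' (Λ.Preg i) = d.p.testBit i := fun i hi => by
    have h1 := Λ.Preg_lt_as hi
    rw [Λ.xv_of_lt _ (by omega), hx'off _ _ (by unfold Preg; omega), ← Λ.xv_of_lt x (by omega)]; exact hP i hi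
  have hx'T : ∀ i, i < Λ.n + 1 → Λ.xv x' (Λ.T2n i) = (2 ^ Λ.n).testBit i := fun i hi => by
    have h1 := Λ.T2n_lt_as hi
    rw [Λ.xv_of_lt _ (by omega), hx'off _ _ (by unfold T2n; omega), ← Λ.xv_of_lt x (by omega)]; exact hT i hi
  have hx'area : ∀ q (hq : q < Λ.n₁), Λ.as ≤ q → x' ⟨q, hq⟩ = false := fun q hq hle => by
    rw [hx'off _ _ (by omega)]; exact harea q hq hle
  -- stage 2: `Y ^= s + jp`
  have hfn₂ : mach₂.fn (PXor.pairStr (PXor.regs Λ.Wd_pos Λ.fs₂ (tri x' (fun _ => false) (fun _ => false)))) = natE yv := by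
    have hregs : PXor.regs Λ.Wd_pos Λ.fs₂ (tri x' (fun _ => false) (fun _ => false)) =
        [Layout.bitsLE s Λ.n, Layout.bitsLE jv Λ.lam, Layout.bitsLE d.p Λ.n] := by
      rw [Λ.regs_fs₂]
      simp only [Layout.bitsLE, List.cons.injEq, and_true]
      exact ⟨List.map_congr_left fun i hi => hx'X i (List.mem_range.1 hi), List.map_congr_left fun i hi => hx'J i (List.mem_range.1 hi),
        List.map_congr_left fun i hi => hx'P i (List.mem_range.1 hi)⟩
    rw [hregs, show PXor.pairStr [Layout.bitsLE s Λ.n, Layout.bitsLE jv Λ.lam, Layout.bitsLE d.p Λ.n] =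
      combineE (Layout.bitsLE s Λ.n, (Layout.bitsLE jv Λ.lam, Layout.bitsLE d.p Λ.n)) from rfl, mach₂, Mach.ofCodeFP_fn]
    simp only [bitsToNat_bitsLE, Nat.mod_eq_of_lt hs, Nat.mod_eq_of_lt hjv, hpn, combineVal, hyv]
  have hM₂ := mach₂.spec (PXor.pairStr (PXor.regs Λ.Wd_pos Λ.fs₂ (tri x' (fun _ => false) (fun _ => false))))
  rw [hfn₂] at hM₂
  have htop₂ : PXor.top mach₂.e mach₂.M Λ.as Λ.fs₂ ≤ Λ.n₁ := by rw [Λ.top_eq Λ.length_slots_fs.2.1]; exact Λ.tops_le.2.1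
  set z₂ := clEval (PXor.ops Λ.Wd_pos mach₂.e mach₂.M Λ.as Λ.fs₂ Λ.kap Λ.Y) (tri x' (fun _ => false) (fun _ => false)) with hz₂
  have hz₂eq : z₂ = tri x' (fun _ => false) (Λ.yp yv 0) := by
    refine Λ.eq_tri_of_parts (ρ := fun _ => false) (fun q hq => ?_) (fun l => ?_)
    · rw [hz₂]
      refine PXor.clEval_ops_of_ne Λ.geom₂ _ q fun j hj h => ?_
      have := congrArg Fin.val h
      rw [CleanXor.tgt, val_finOf_of_lt _ (Λ.Y_lt_Wd hj)] at this
      simp only [Y] at this; omega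
    · by_cases hl : (l : ℕ) < Λ.kap
      · have hlw : Fin.natAdd Λ.n₁ (Fin.natAdd Λ.k l) = CleanXor.tgt Λ.Wd_pos Λ.Y l := by
          rw [CleanXor.tgt, show finOf Λ.Wd Λ.Wd_pos (Λ.Y l) = Λ.fin (Λ.Y l) from rfl, Λ.fin_Y_eq hl]
        rw [hlw, hz₂, PXor.clEval_ops_target Λ.geom₂ _ (Λ.clean_of_XGood' hx'area _ _ htop₂) (natE yv) hM₂ hl, ← hlw, tri_work,
          decide_getElem?_natE]
        simp [yp, hl]
      · have hne : ∀ j, j < Λ.kap → Fin.natAdd Λ.n₁ (Fin.natAdd Λ.k l) ≠ CleanXor.tgt Λ.Wd_pos Λ.Y j := fun j hj h => by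
          have := congrArg Fin.val h
          rw [CleanXor.tgt, val_finOf_of_lt _ (Λ.Y_lt_Wd hj)] at this
          simp only [Y, Fin.natAdd] at this; omega
        rw [hz₂, PXor.clEval_ops_of_ne Λ.geom₂ _ _ hne, tri_work]
        simp [yp, hl]
  -- stage 3: `X ++ J ^= split Y`
  have hfn₃ : mach₃.fn (PXor.pairStr (PXor.regs Λ.Wd_pos Λ.fs₃ z₂)) = natE (s + 2 ^ Λ.n * jv) := by
    have hregs : PXor.regs Λ.Wd_pos Λ.fs₃ z₂ = [Layout.bitsLE yv Λ.kap, Layout.bitsLE d.p Λ.n, Layout.bitsLE (2 ^ Λ.n) (Λ.n + 1)] := by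
      rw [hz₂eq, Λ.regs_fs₃]
      simp only [Layout.bitsLE, List.cons.injEq, and_true, true_and]
      exact ⟨List.map_congr_left fun i hi => hx'P i (List.mem_range.1 hi), List.map_congr_left fun i hi => hx'T i (List.mem_range.1 hi)⟩
    rw [hregs, show PXor.pairStr [Layout.bitsLE yv Λ.kap, Layout.bitsLE d.p Λ.n, Layout.bitsLE (2 ^ Λ.n) (Λ.n + 1)] =
      combineE (Layout.bitsLE yv Λ.kap, (Layout.bitsLE d.p Λ.n, Layout.bitsLE (2 ^ Λ.n) (Λ.n + 1))) from rfl, mach₃, Mach.ofCodeFP_fn]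
    simp only [bitsToNat_bitsLE, hyvm, hpn, h2n]
    rw [hyv, show s + jv * d.p = combineVal s jv d.p from rfl, splitVal_combineVal hsp]
  have hM₃ := mach₃.spec (PXor.pairStr (PXor.regs Λ.Wd_pos Λ.fs₃ z₂))
  rw [hfn₃] at hM₃
  have htop₃ : PXor.top mach₃.e mach₃.M Λ.as Λ.fs₃ ≤ Λ.n₁ := by rw [Λ.top_eq Λ.length_slots_fs.2.2.1]; exact Λ.tops_le.2.2.1
  have hclean₃ : ∀ q, Λ.as ≤ q → q < PXor.top mach₃.e mach₃.M Λ.as Λ.fs₃ → z₂ (finOf Λ.Wd Λ.Wd_pos q) = false := by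
    rw [hz₂eq]; exact Λ.clean_of_XGood' hx'area _ _ htop₃
  have htlt : ∀ j, j < Λ.n + Λ.lam → Λ.tXJ j < Λ.n₁ := fun j hj => by
    unfold tXJ; split_ifs with h
    · have := Λ.X_lt_as h; omega
    · have := Λ.J_lt_as (i := j - Λ.n) (by omega); omega
  have htgt : ∀ j, j < Λ.n + Λ.lam → CleanXor.tgt Λ.Wd_pos Λ.tXJ j = Λ.fin (Λ.tXJ j) := fun j hj => rfl
  -- read off the result wire by wire
  show clEval _ z₂ = _
  funext q
  by_cases hq1 : (q : ℕ) < Λ.n₁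
  · have hqf : q = Λ.fin q := Fin.ext (by rw [fin, val_finOf_of_lt _ q.isLt])
    by_cases hqX : Λ.X 0 ≤ (q : ℕ) ∧ (q : ℕ) < Λ.X 0 + Λ.n
    · -- an `X` wire: cleared
      obtain ⟨i, hi, hqi⟩ : ∃ i, i < Λ.n ∧ q = Λ.fin (Λ.X 0 + i) :=
        ⟨q - Λ.X 0, by omega, Fin.ext (by rw [fin, val_finOf_of_lt _ (by omega)]; omega)⟩
      subst hqi
      have hXi : Λ.X 0 + i < Λ.n₁ := by omega
      have htXJ : Λ.tXJ i = Λ.X 0 + i := by unfold tXJ; rw [if_pos hi]; unfold X; omega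
      have htg : CleanXor.tgt Λ.Wd_pos Λ.tXJ i = Λ.fin (Λ.X 0 + i) := by rw [htgt i (by omega), htXJ]
      rw [← htg, PXor.clEval_ops_target Λ.geom₃ z₂ hclean₃ _ hM₃ (show i < Λ.n + Λ.lam by omega), htg, hz₂eq,
        Λ.tri_fin_of_lt _ _ _ hXi, Λ.tri_fin_of_lt _ _ _ hXi, decide_getElem?_natE, testBit_add_two_pow_mul hs, if_pos hi,
        hx', Λ.setReg_of_not _ _ (by simp only; omega), Λ.setReg_of_mem _ _ hi, Nat.zero_testBit]
      have := hX i hi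
      rw [Λ.xv_of_lt _ (by have := hXcs i hi; omega)] at this
      rw [show (⟨Λ.X 0 + i, hXi⟩ : Fin Λ.n₁) = ⟨Λ.X i, by have := hXcs i hi; omega⟩ from Fin.ext (by simp only; unfold X; omega), this,
        Bool.xor_self]
    · by_cases hqJ : Λ.J 0 ≤ (q : ℕ) ∧ (q : ℕ) < Λ.J 0 + Λ.lam
      · -- a `J` wire: cleared
        obtain ⟨i, hi, hqi⟩ : ∃ i, i < Λ.lam ∧ q = Λ.fin (Λ.J 0 + i) :=
          ⟨q - Λ.J 0, by omega, Fin.ext (by rw [fin, val_finOf_of_lt _ (by omega)]; omega)⟩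
        subst hqi
        have hJi : Λ.J 0 + i < Λ.n₁ := by omega
        have htXJ : Λ.tXJ (Λ.n + i) = Λ.J 0 + i := by unfold tXJ; rw [if_neg (by omega)]; unfold J; omega
        have htg : CleanXor.tgt Λ.Wd_pos Λ.tXJ (Λ.n + i) = Λ.fin (Λ.J 0 + i) := by rw [htgt _ (by omega), htXJ]
        rw [← htg, PXor.clEval_ops_target Λ.geom₃ z₂ hclean₃ _ hM₃ (show Λ.n + i < Λ.n + Λ.lam by omega), htg, hz₂eq,
          Λ.tri_fin_of_lt _ _ _ hJi, Λ.tri_fin_of_lt _ _ _ hJi, decide_getElem?_natE, testBit_add_two_pow_mul hs, if_neg (by omega),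
          Nat.add_sub_cancel_left, hx', Λ.setReg_of_mem _ _ hi, Bool.xor_self, Λ.setReg_of_not _ _ (by simp only; omega)]
        have := hJ i hi
        rw [Λ.xv_of_lt _ (by have := Λ.J_lt_as hi; omega)] at this
        rw [show (⟨Λ.J 0 + i, hJi⟩ : Fin Λ.n₁) = ⟨Λ.J i, by have := Λ.J_lt_as hi; omega⟩ from Fin.ext (by simp only; unfold J; omega), this]
      · -- any other first-part wire: unchanged
        rw [PXor.clEval_ops_of_ne Λ.geom₃ z₂ q fun j hj h => ?_, hz₂eq, hqf, Λ.tri_fin_of_lt _ _ _ hq1, Λ.tri_fin_of_lt _ _ _ hq1,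
          hx'off _ _ hqJ, Λ.setReg_of_not _ _ (by simpa using hqX)]
        have := congrArg Fin.val h
        rw [htgt j hj, fin, val_finOf_of_lt _ (by have := htlt j hj; omega)] at this
        revert this hqX hqJ; unfold tXJ; split_ifs <;> unfold X J <;> omega
  · -- beyond the first part: unchanged, and the two labels agree there
    rw [PXor.clEval_ops_of_ne Λ.geom₃ z₂ q fun j hj h => ?_, hz₂eq]
    · exact Λ.tri_apply_eq_of_le _ _ _ _ q (by omega)
    · have := congrArg Fin.val h
      rw [htgt j hj, fin, val_finOf_of_lt _ (by have := htlt j hj; omega)] at this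
      have := htlt j hj; omega

end Layout









end CubicBlock

end VanDamSeroussi

end Literature.Computability.Cryptography
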